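import Literature.Analysis.FluidPDE.Tao2016AveragedNS.SelfSimilarCascadeResidues
import Literature.Analysis.FluidPDE.Tao2016AveragedNS.ViscousEternalSolutions

/-!
# Tao 2016, §4: BOUNDED («type-I») admissible eternal solutions of the renormalised lattice
# — the quadratic tail recursion under covariant viscosity, the bounded viscous pair, and
# boundedness of DSS profiles (LEMMA LAYER, fourth part)

T. Tao, *Finite time blowup for an averaged three-dimensional Navier–Stokes equation*, J. Amer.
Math. Soc. **29** (2016) 601–674 = arXiv:1402.0290v3 [`Tao2016AveragedNS`]: §4 (the cascade
tables (4.1), Lemma 4.1 (4.8)–(4.10) and the cancellation (4.3), the viscous equation displayed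
before Theorem 4.2, Theorem 4.2) and §6.4 (renormalised variables).

This module extends the lemma layers `SelfSimilarCascadeResidues` (abstract profile systems
`IsSWave`, DSS waves `IsDSSWave`, `dssEmbed`, `fluxConst`, the table dictionary) and
`ViscousEternalSolutions` (`IsEternalVisc`, `NoSurvivingEternalVisc`, `EternalRigidityVisc`) over the
definition module `RenormalisedCascadeWaves` (`physEnergy`, `physFlux`, `physWeight`, `bigLam`,
`EternalSurvivingFwd`).  It was requested by cell harvest/h2-tao-ladder (planner theory-1 g8 and the
cell referee, cycle 23; author planner theory-2 g8; sources: the kernel-checked cell files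
`d6/K1InfVisc.lean` v4, sha16 ac3b48511ec2c482, and `d6/DSSBounded.lean`, sha16 7558834bb2ff876c)
to make the BOUNDED form of the cell's eternal pair, its glue, and two proved lemma families
citable by name from ONE place.  Everything here is a PREDICATE WITH PARAMETERS, an IMPLICATION
between such predicates, or a theorem about solutions of MODEL lattice ODEs; nothing is asserted
about any particular table beyond what is proved, and NOTHING in this file is a statement about
the Navier–Stokes equations.  The cell's closed claims (`∀ R ≥ 1, NoSurvivingEternalBdd R 1`,
`∀ R ≥ 1, NoLoudLadder R`, `∀ R ≥ 1, EternalRigidityViscBdd R 1`, …) are conjectures and therefore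
ROUTE ITEMS under `Summits/…`, not declarations of this file.

Physical variables: `X_n(t) = Λ^{-n} e^{σ} W_n(σ)`, `t⋆ - t = e^{-σ}`, `E_n = physEnergy`,
`F_n = physFlux`; the a=1-weighted renormalised energy is `p_n = wtEnergy = (1+ε₀)^n E_n`
(`wtEnergy_eq`), and forward (S₁)-survival (`EternalSurvivingFwd 1`) is non-decay of `p_n`.

* VOCABULARY. `wtEnergy`; `TypeIBound W n₀` (`sup_{k > n₀, σ} ‖W_k(σ)‖ < ∞`, i.e. the
  scale-critical rate `‖X_k(t)‖ ≤ C Λ^{-k}/(t⋆ - t)`) and `UniformBound W` (the same above every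
  shell); `viscCoef` (the covariant viscosity coefficient `ν̂ (1+ε₀)^{2k} e^{-σ}` of
  `IsEternalVisc.law`); the ceiling sequence `ceilSeq`; the statements `TailRecursionAt R K εs`,
  `QuadraticTailRecursion`, `NoSurvivingViscSeededBdd R K` (the dissipation-dominated slice); the
  BOUNDED pair `NoSurvivingEternalViscBdd R a` (viscous Liouville for uniformly bounded admissible
  eternal solutions — WEAKER than `NoSurvivingEternalVisc`, `noSurvivingEternalViscBdd_of_visc`) and
  `EternalRigidityViscBdd R a` (blow-up forces a uniformly bounded one — STRONGER than
  `EternalRigidityVisc`, `eternalRigidityVisc_of_bdd`; it is what an ω-limit extraction from a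
  type-I blow-up trajectory would deliver); the bounded INVISCID predicate `NoSurvivingEternalBdd R a`
  (weaker than `NoSurvivingEternalFwd`, `noSurvivingEternalBdd_of_fwd`) and the loud-ladder
  exclusion `NoLoudLadder R` (`ν̂ > 0`, bounded, every shell reaches the dissipation-critical level).
* THE SHELL ENERGY IDENTITY `E_k' = F_{k-1} - F_k - 2ν̂(1+ε₀)^{2k}e^{-σ}E_k` (`hasDerivAt_physEnergy`;
  the cancellation (4.3) turns the back-reaction pairing into minus the outgoing flux pairing, so
  there is no separate `B`-type term), `|F_k| ≤ 2 C_A Λ⁻¹ ‖W_{k+1}‖ E_k` (`abs_physFlux_le`), and the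
  finite-tail balance (`hasDerivAt_tail`, `diss_ge`, `tail_le_far`, `exists_tailLength`).
* THE SHELL STEP `physEnergy_succ_le`: under the type-I bound above `n₀`, `N ≥ n₀` and
  `E_N ≤ S^E` at all log-times ⟹ `E_{N+1} ≤ (C_A Λ^N S^E/(ν̂(1+ε₀)^{2(N+1)}))²` at all log-times
  (barrier argument on `(-∞, σ₁]` for a finite tail whose top boundary flux is made small by the
  tail length; private real-variable helpers `bracket_neg`, `pastBarrier`, `le_sq_of_forall_level`;
  no infinite sum is ever formed).
* DISSIPATION-RANGE DECAY `farPastDecay` (v2): under the uniform bound `‖W_k(σ)‖ ≤ B` and `ν̂ > 0`,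
  every shell `k ≥ 1` obeys `‖W_k(σ)‖ ≤ C_A Λ B² e^{σ}/(ν̂ (1+ε₀)^{2k})` at every log-time — bounded
  viscous eternal solutions are exponentially small in the far past and above the dissipation cutoff
  `(1+ε₀)^{2k_d(σ)} = C_A Λ B e^{σ}/ν̂`; from the past-local shell step `physEnergy_succ_le_past`
  (the hypothesis `E_N ≤ S^E` is needed on `(-∞, σ₁]` only; `physEnergy_succ_le` is its global corollary).
* SHIFT SYMMETRY `isEternalVisc_shift` (v3): `(n, σ) ↦ (n + d, σ + 2d log(1+ε₀))` preserves `IsEternalVisc`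
  with the same `ν̂`; hence `farPastDecay_all`: the dissipation-range bound on EVERY shell `k ∈ ℤ`.
* (τ′) THE QUADRATIC TAIL RECURSION `tailRecursionAt_4096 : ∀ R εs, TailRecursionAt R 4096 εs` and
  `quadraticTailRecursion` (`K = 4096 = (4³)²` from `C_A ≤ 64` on tables with entries in `[-1,1]`,
  spread-independent), the decay of quadratic recursions (private helpers `quadRecursion_bound`,
  `quadRecursion_eventually_lt`), `not_surviving_of_ceilings`, and the composition
  `noSurvivingViscSeededBdd : ∀ R, NoSurvivingViscSeededBdd R 4096` — THE DISSIPATION-DOMINATED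
  SLICE of the viscous Liouville predicate at `a = 1` is a THEOREM: an admissible viscous eternal
  solution (`ν̂ > 0`) of an E₂(R) table obeying the type-I bound above a seed shell (a=1-weighted
  energy `< ν̂²/4096` at all log-times) is not forward (S₁)-surviving.  The only exhibited member of
  the hypothesis class is `W = 0` (`seed_of_zero`); a nonzero one is an existence problem.
* THE BOUNDED PAIR: glue `noRobustBlowupBelow_of_eternalViscBdd` (bounded Liouville + bounded
  rigidity ⇒ `NoRobustBlowupBelow R`), and the decomposition of the bounded Liouville predicate at
  `a = 1` into the proved slice and two residual predicates,
  `noSurvivingEternalViscBddOne_of : NoSurvivingEternalBdd R 1 → NoLoudLadder R →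
  NoSurvivingEternalViscBdd R 1` (case split `ν̂ = 0` / seeded / unseeded), composed in
  `noRobustBlowupBelow_of_bdd`.
* DSS PROFILES ARE BOUNDED: for an abstract profile system `IsSWave π Q A B d c₁ c₂ T Φ` (`T ≥ 0`)
  with quadratic / bilinear structure maps, integrable summed mass and a bound on a right
  half-line, the summed mass is bounded on all of `ℝ` (`sMass_bounded`; «front property»: a tall
  spike far in the past must be fed, through the quadratic couplings, by mass in a window of length
  `T` around it, and that mass tends to zero — a sup argument on compact windows anchored at
  far-left points where the mass is `≤ 1`, via `sMass_key_estimate`).  Hence every admissible DSS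
  wave of ANY finite table has bounded profiles (`IsDSSWave.uniformBound`, with the table norm
  bounds `norm_tableQ_le` / `norm_tableA_le` / `norm_tableB_le` in terms of `shiftConst`), the
  eternal solution it carries satisfies `UniformBound` (`uniformBound_dssEmbed`), and the bounded
  inviscid predicate still excludes surviving DSS waves:
  `noSurvivingDSS_of_noSurvivingEternalBdd : NoSurvivingEternalBdd R a → NoSurvivingDSS R a`.
-/

open Set Filter Topology MeasureTheory intervalIntegral
open scoped RealInnerProductSpace

namespace Literature.Analysis.FluidPDE

namespace TaoCascade

/-! ## Vocabulary -/

section Vocabulary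

variable {m : ℕ}

/-- The a=1-weighted renormalised shell energy `p_n(σ) = physWeight(1)^n · e^{2σ}‖W_n(σ)‖²`
(`= (1+ε₀)^n E_n` in physical variables, `wtEnergy_eq`) — the quantity whose non-decay IS forward
(S₁)-survival.
[cite: Tao2016AveragedNS, §4 Thm. 4.2 (statement shape), Lemma 4.1 (4.8), §6.4; cell vocabulary] -/
noncomputable def wtEnergy (ε₀ : ℝ) {m : ℕ} (W : ℤ → ℝ → Em m) (n : ℕ) (σ : ℝ) : ℝ :=
  physWeight 1 ε₀ ^ n * (Real.exp (2 * σ) * ‖W n σ‖ ^ 2)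

/-- **Type-I (scale-critical) bound above shell `n₀`**: `sup_{k > n₀, σ} ‖W_k(σ)‖ < ∞`, i.e.
`‖X_k(t)‖ ≤ C Λ^{-k}/(t⋆ - t)` in physical variables.
[cite: Tao2016AveragedNS, §4 Thm. 4.2 (statement shape), Lemma 4.1 (4.8), §6.4; cell vocabulary] -/
def TypeIBound {m : ℕ} (W : ℤ → ℝ → Em m) (n₀ : ℕ) : Prop :=
  ∃ C : ℝ, ∀ k : ℤ, (n₀ : ℤ) < k → ∀ σ : ℝ, ‖W k σ‖ ≤ C

/-- **Uniform («type-I») bound** on an eternal solution: `sup_{k,σ} ‖W_k(σ)‖ < ∞`, i.e.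
`‖X_k(t)‖ ≤ C Λ^{-k}/(t⋆ - t)` at every shell.
[cite: Tao2016AveragedNS, §4 Thm. 4.2 (statement shape), Lemma 4.1 (4.8), §6.4; cell vocabulary] -/
def UniformBound {m : ℕ} (W : ℤ → ℝ → Em m) : Prop :=
  ∃ C : ℝ, ∀ (k : ℤ) (σ : ℝ), ‖W k σ‖ ≤ C

/-- A uniform bound is a type-I bound above every shell.
[cite: Tao2016AveragedNS, §4 Thm. 4.2 (statement shape), Lemma 4.1 (4.8), §6.4; cell vocabulary] -/
theorem typeIBound_of_uniformBound {m : ℕ} {W : ℤ → ℝ → Em m} (h : UniformBound W) (n₀ : ℕ) :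
    TypeIBound W n₀ := by
  obtain ⟨C, hC⟩ := h
  exact ⟨C, fun k _ σ => hC k σ⟩

/-- The covariant viscosity coefficient of shell `k` at log-time `σ`: `ν̂ (1+ε₀)^{2k} e^{-σ}`
(verbatim the coefficient of `IsEternalVisc.law`).
[cite: Tao2016AveragedNS, §4, the viscous equation displayed before Thm. 4.2, in the self-similar variables of §6.4; cell vocabulary] -/
noncomputable def viscCoef (ε₀ νh : ℝ) (k : ℤ) (σ : ℝ) : ℝ :=
  νh * ((1 + ε₀) ^ ((2 : ℝ) * k) * Real.exp (-σ))

/-- The ceiling sequence `T₀ = s₀`, `T_{j+1} = L T_j²`.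
[folklore] -/
noncomputable def ceilSeq (L s₀ : ℝ) : ℕ → ℝ
  | 0 => s₀
  | j + 1 => L * ceilSeq L s₀ j ^ 2

/-- **(τ′) at spread `R`, constant `K`, threshold `εs`**: every admissible viscous eternal solution
(`ν̂ > 0`) of an E₂(R) table obeying the type-I bound above a SEED shell `n₀` (weighted energy
`< ν̂²/K` at all log-times) admits weighted shell CEILINGS `S n ≥ sup_σ p_n(σ)`, `n ≥ n₀`, with
`S(n+1) ≤ (K/ν̂²) S(n)²` and `(K/ν̂²) S(n₀) < 1`.
[cite: Tao2016AveragedNS, §4 Thm. 4.2 (statement shape), Lemma 4.1 (4.8), §6.4; cell vocabulary] -/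
def TailRecursionAt (R K εs : ℝ) : Prop :=
  ∀ ε₀ : ℝ, 0 < ε₀ → ε₀ ≤ εs →
    ∀ α : Fin 4 → Fin 4 → Fin 4 → ℤ × ℤ × ℤ → ℝ, InTableClass R α →
      ∀ (νh : ℝ) (W : ℤ → ℝ → Em 4), 0 < νh → IsEternalVisc ε₀ νh α W →
        ∀ n₀ : ℕ, TypeIBound W n₀ →
          (∃ s₀ : ℝ, s₀ < νh ^ 2 / K ∧ ∀ σ : ℝ, wtEnergy ε₀ W n₀ σ ≤ s₀) →
          ∃ S : ℕ → ℝ, (∀ n, n₀ ≤ n → ∀ σ, wtEnergy ε₀ W n σ ≤ S n) ∧ (∀ n, n₀ ≤ n → 0 ≤ S n) ∧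
            (∀ n, n₀ ≤ n → S (n + 1) ≤ K / νh ^ 2 * S n ^ 2) ∧ K / νh ^ 2 * S n₀ < 1

/-- **(τ′) THE QUADRATIC TAIL RECURSION under the type-I bound**, for every spread `R ≥ 1` with some
constant and threshold.  PROVED below (`quadraticTailRecursion`, with `K = 4096`, `εs = 1`).
[cite: Tao2016AveragedNS, §4 Thm. 4.2 (statement shape), Lemma 4.1 (4.8), §6.4; cell vocabulary] -/
def QuadraticTailRecursion : Prop :=
  ∀ R : ℝ, 1 ≤ R → ∃ K : ℝ, 0 < K ∧ ∃ εs : ℝ, 0 < εs ∧ TailRecursionAt R K εs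

/-- **The dissipation-dominated slice of the viscous Liouville predicate** at spread `R` with
constant `K`: below a threshold, an admissible viscous eternal solution (`ν̂ > 0`) of an E₂(R) table
obeying the type-I bound above a seed shell `n₀` (weighted energy `< ν̂²/K` at all log-times) is
not forward (S₁)-surviving.  PROVED below for `K = 4096` (`noSurvivingViscSeededBdd`).
[cite: Tao2016AveragedNS, §4 Thm. 4.2 (statement shape), Lemma 4.1 (4.8), §6.4; cell vocabulary] -/
def NoSurvivingViscSeededBdd (R K : ℝ) : Prop :=
  ∃ εs : ℝ, 0 < εs ∧ ∀ ε₀ : ℝ, 0 < ε₀ → ε₀ ≤ εs →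
    ∀ α : Fin 4 → Fin 4 → Fin 4 → ℤ × ℤ × ℤ → ℝ, InTableClass R α →
      ∀ (νh : ℝ) (W : ℤ → ℝ → Em 4), 0 < νh → IsEternalVisc ε₀ νh α W →
        ∀ n₀ : ℕ, TypeIBound W n₀ →
          (∃ s₀ : ℝ, s₀ < νh ^ 2 / K ∧ ∀ σ : ℝ, wtEnergy ε₀ W n₀ σ ≤ s₀) →
          ¬ EternalSurvivingFwd 1 ε₀ W

/-- **`NoSurvivingEternalViscBdd R a`** — viscous Liouville for UNIFORMLY BOUNDED admissible eternal
solutions: below a threshold, no E₂(R) table carries a uniformly bounded admissible eternal solution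
with covariant viscosity (any `ν̂ ≥ 0`) that is (S_a)-surviving forward in log-time.  A predicate;
nothing is asserted (the Koch–Nadirashvili–Seregin–Šverák shape «type-I blow-up is excluded iff
bounded ancient solutions are trivial», on the model lattice).
[cite: Tao2016AveragedNS, §4 Thm. 4.2 (statement shape), Lemma 4.1 (4.8), §6.4; cell vocabulary] -/
def NoSurvivingEternalViscBdd (R a : ℝ) : Prop :=
  ∃ εs : ℝ, 0 < εs ∧ ∀ ε₀ : ℝ, 0 < ε₀ → ε₀ ≤ εs →
    ∀ α : Fin 4 → Fin 4 → Fin 4 → ℤ × ℤ × ℤ → ℝ, InTableClass R α →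
      ∀ (νh : ℝ) (W : ℤ → ℝ → Em 4), IsEternalVisc ε₀ νh α W → UniformBound W →
        ¬ EternalSurvivingFwd a ε₀ W

/-- **`EternalRigidityViscBdd R a`** — robust blow-up below the threshold forces a UNIFORMLY BOUNDED
admissible viscous eternal solution (some `ν̂ ≥ 0`) surviving forward at exponent `a` (what an
ω-limit extraction from a type-I blow-up trajectory would deliver).  A predicate; nothing is asserted.
[cite: Tao2016AveragedNS, §4 Thm. 4.2 (statement shape), Lemma 4.1 (4.8), §6.4; cell vocabulary] -/
def EternalRigidityViscBdd (R a : ℝ) : Prop :=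
  ∃ εs : ℝ, 0 < εs ∧ ∀ ε₀ : ℝ, 0 < ε₀ → ε₀ ≤ εs →
    ∀ (α : Fin 4 → Fin 4 → Fin 4 → ℤ × ℤ × ℤ → ℝ) (X₀ : Fin 4 → ℝ), InTableClass R α →
      NoGlobalCascade ε₀ α X₀ →
        ∃ (νh : ℝ) (W : ℤ → ℝ → Em 4), IsEternalVisc ε₀ νh α W ∧ UniformBound W ∧
          EternalSurvivingFwd a ε₀ W

/-- **`NoSurvivingEternalBdd R a`** — the bounded INVISCID Liouville predicate: the tree's
`NoSurvivingEternalFwd R a` restricted to uniformly bounded admissible eternal solutions (below a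
threshold, no E₂(R) table carries a uniformly bounded admissible eternal solution that is
(S_a)-surviving forward in log-time).  A predicate; nothing is asserted.  It is the `ν̂ = 0` part of
`NoSurvivingEternalViscBdd`, and by `uniformBound_dssEmbed` it still excludes surviving DSS waves
(`noSurvivingDSS_of_noSurvivingEternalBdd`).
[cite: Tao2016AveragedNS, §4 Thm. 4.2 (statement shape), Lemma 4.1 (4.8), §6.4; cell vocabulary] -/
def NoSurvivingEternalBdd (R a : ℝ) : Prop :=
  ∃ εs : ℝ, 0 < εs ∧ ∀ ε₀ : ℝ, 0 < ε₀ → ε₀ ≤ εs →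
    ∀ α : Fin 4 → Fin 4 → Fin 4 → ℤ × ℤ × ℤ → ℝ, InTableClass R α →
      ∀ W : ℤ → ℝ → Em 4, IsEternal ε₀ α W → UniformBound W → ¬ EternalSurvivingFwd a ε₀ W

/-- **`NoLoudLadder R`** — loud-ladder exclusion (`ν̂ > 0`): below a threshold, a uniformly bounded
admissible viscous eternal solution of an E₂(R) table in which EVERY shell reaches the
dissipation-critical level `ν̂²/4096` of its a=1-weighted energy at some log-time (no seed anywhere)
is not forward (S₁)-surviving.  A predicate; nothing is asserted — it is the complement of the proved
slice inside `NoSurvivingEternalViscBdd R 1` (`noSurvivingEternalViscBddOne_of`).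
[cite: Tao2016AveragedNS, §4 Thm. 4.2 (statement shape), Lemma 4.1 (4.8), §6.4; cell vocabulary] -/
def NoLoudLadder (R : ℝ) : Prop :=
  ∃ εs : ℝ, 0 < εs ∧ ∀ ε₀ : ℝ, 0 < ε₀ → ε₀ ≤ εs →
    ∀ α : Fin 4 → Fin 4 → Fin 4 → ℤ × ℤ × ℤ → ℝ, InTableClass R α →
      ∀ (νh : ℝ) (W : ℤ → ℝ → Em 4), 0 < νh → IsEternalVisc ε₀ νh α W → UniformBound W →
        (∀ n₀ : ℕ, ∀ s₀ : ℝ, s₀ < νh ^ 2 / 4096 → ∃ σ : ℝ, s₀ < wtEnergy ε₀ W n₀ σ) →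
          ¬ EternalSurvivingFwd 1 ε₀ W

end Vocabulary

section ViscousTail

variable {m : ℕ}

/-! ## The shell energy identity (cancellation (4.3); no `B`-type term) -/

/-- `d/dx e^{2x} = 2 e^{2x}`.
[folklore] -/
private theorem hasDerivAt_exp_two_mul (σ : ℝ) :
    HasDerivAt (fun x : ℝ => Real.exp (2 * x)) (2 * Real.exp (2 * σ)) σ := by
  have h := ((hasDerivAt_id σ).const_mul (2 : ℝ)).exp
  simp only [id, mul_one] at h
  convert h using 1
  ring

/-- The renormalised shell energy identity with covariant viscosity: `d/dσ (e^{2σ}‖W_k‖²) = e^{2σ}(2Λ⟪W_k, A W_{k-1}⟫ - 2Λ⁻¹⟪W_{k+1}, A W_k⟫ - 2·viscCoef·‖W_k‖²)` — cancellation (4.3) turns the back-reaction pairing into minus the outgoing flux pairing; the damping term is absorbed by the weight `e^{2σ}`.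
[cite: Tao2016AveragedNS, §4 Lemma 4.1 (4.8)–(4.10) with the viscous equation displayed before Thm. 4.2, shell-wise in the self-similar variables of §6.4; cell lemma] -/
theorem hasDerivAt_renE {ε₀ νh : ℝ} {α : Fin m → Fin m → Fin m → ℤ × ℤ × ℤ → ℝ} {W : ℤ → ℝ → Em m}
    (hW : IsEternalVisc ε₀ νh α W) (hc : IsCancellingCoeff α) (k : ℤ) (σ : ℝ) :
    HasDerivAt (fun x => Real.exp (2 * x) * ‖W k x‖ ^ 2)
      (Real.exp (2 * σ) * (2 * bigLam ε₀ * ⟪W k σ, tableA α (W (k - 1) σ)⟫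
        - 2 * (bigLam ε₀)⁻¹ * ⟪W (k + 1) σ, tableA α (W k σ)⟫
        - 2 * viscCoef ε₀ νh k σ * ‖W k σ‖ ^ 2)) σ := by
  have hS := table_sTable α hc
  have h1 := (hW.law k σ).norm_sq
  have e : 2 * ⟪W k σ, -((1 : ℝ) • W k σ) + tableQ α (W k σ) + bigLam ε₀ • tableA α (W (k - 1) σ)
      + (bigLam ε₀)⁻¹ • tableB α (W (k + 1) σ) (W k σ)
      - (νh * ((1 + ε₀) ^ ((2 : ℝ) * k) * Real.exp (-σ))) • W k σ⟫
      = 2 * bigLam ε₀ * ⟪W k σ, tableA α (W (k - 1) σ)⟫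
        - 2 * (bigLam ε₀)⁻¹ * ⟪W (k + 1) σ, tableA α (W k σ)⟫
        - 2 * ‖W k σ‖ ^ 2 - 2 * viscCoef ε₀ νh k σ * ‖W k σ‖ ^ 2 := by
    rw [inner_sub_right, inner_add_right, inner_add_right, inner_add_right, inner_neg_right,
      real_inner_smul_right, real_inner_smul_right, real_inner_smul_right, real_inner_smul_right,
      real_inner_self_eq_norm_sq, hS.intra]
    have hcan := hS.cancel (W k σ) (W (k + 1) σ)
    unfold viscCoef
    linear_combination (2 * (bigLam ε₀)⁻¹) * hcan
  have h2 : HasDerivAt (fun x => Real.exp (2 * x) * ‖W k x‖ ^ 2)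
      (2 * Real.exp (2 * σ) * ‖W k σ‖ ^ 2 + Real.exp (2 * σ) *
        (2 * bigLam ε₀ * ⟪W k σ, tableA α (W (k - 1) σ)⟫
        - 2 * (bigLam ε₀)⁻¹ * ⟪W (k + 1) σ, tableA α (W k σ)⟫
        - 2 * ‖W k σ‖ ^ 2 - 2 * viscCoef ε₀ νh k σ * ‖W k σ‖ ^ 2)) σ :=
    (hasDerivAt_exp_two_mul σ).mul (h1.congr_deriv e)
  refine h2.congr_deriv ?_
  ring

/-- **The physical shell energy identity** `E_k' = F_{k-1} - F_k - 2 ν̂ (1+ε₀)^{2k} e^{-σ} E_k` (`E_k = physEnergy`, `F_k = physFlux`): no separate `B`-type term.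
[cite: Tao2016AveragedNS, §4 Lemma 4.1 (4.8)–(4.10) with the viscous equation displayed before Thm. 4.2, shell-wise in the self-similar variables of §6.4; cell lemma] -/
theorem hasDerivAt_physEnergy {ε₀ νh : ℝ} {α : Fin m → Fin m → Fin m → ℤ × ℤ × ℤ → ℝ}
    {W : ℤ → ℝ → Em m} (hε : 0 < ε₀)
    (hW : IsEternalVisc ε₀ νh α W) (hc : IsCancellingCoeff α) (k : ℤ) (σ : ℝ) :
    HasDerivAt (physEnergy ε₀ W k)
      (physFlux ε₀ α W (k - 1) σ - physFlux ε₀ α W k σ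
        - 2 * viscCoef ε₀ νh k σ * physEnergy ε₀ W k σ) σ := by
  have hΛ : bigLam ε₀ ≠ 0 := (bigLam_pos (by linarith)).ne'
  have h := (hasDerivAt_renE hW hc k σ).const_mul ((bigLam ε₀ ^ k)⁻¹ ^ 2)
  have hfun : (fun x => (bigLam ε₀ ^ k)⁻¹ ^ 2 * (Real.exp (2 * x) * ‖W k x‖ ^ 2))
      = physEnergy ε₀ W k := by
    funext x; rfl
  rw [hfun] at h
  refine h.congr_deriv ?_
  have hF : physFlux ε₀ α W (k - 1) σ = 2 * ((bigLam ε₀ ^ (k - 1))⁻¹ ^ 2 * (bigLam ε₀)⁻¹)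
      * (Real.exp (2 * σ) * ⟪W k σ, tableA α (W (k - 1) σ)⟫) := by
    simp only [physFlux, sub_add_cancel]
  have hz : (bigLam ε₀ ^ (k - 1))⁻¹ ^ 2 * (bigLam ε₀)⁻¹ = (bigLam ε₀ ^ k)⁻¹ ^ 2 * bigLam ε₀ := by
    rw [zpow_sub_one₀ hΛ]
    field_simp
  rw [hF, hz]
  simp only [physFlux, physEnergy]
  ring

/-! ### Norm and flux bounds -/

/-- `0 ≤ E_k(σ)`.
[cite: Tao2016AveragedNS, §4 Lemma 4.1 (4.8)–(4.10) with the viscous equation displayed before Thm. 4.2, shell-wise in the self-similar variables of §6.4; cell lemma] -/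
theorem physEnergy_nonneg (ε₀ : ℝ) (W : ℤ → ℝ → Em m) (k : ℤ) (σ : ℝ) :
    0 ≤ physEnergy ε₀ W k σ := by
  unfold physEnergy; positivity

/-- `1 ≤ Λ` for `ε₀ ≥ 0`.
[cite: Tao2016AveragedNS, §4 (Λ = (1+ε₀)^{5/2}, the weights of Lemma 4.1); cell lemma] -/
theorem one_le_bigLam {ε₀ : ℝ} (hε : 0 ≤ ε₀) : 1 ≤ bigLam ε₀ :=
  Real.one_le_rpow (by linarith) (by norm_num)

/-- `‖W_k(σ)‖ = Λ^k e^{-σ} √(E_k(σ))`.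
[cite: Tao2016AveragedNS, §4 Lemma 4.1 (4.8)–(4.10) with the viscous equation displayed before Thm. 4.2, shell-wise in the self-similar variables of §6.4; cell lemma] -/
theorem norm_eq_sqrt_physEnergy {ε₀ : ℝ} (hε : 0 < ε₀) (W : ℤ → ℝ → Em m) (k : ℤ) (σ : ℝ) :
    ‖W k σ‖ = bigLam ε₀ ^ k * Real.exp (-σ) * Real.sqrt (physEnergy ε₀ W k σ) := by
  have hΛ : 0 < bigLam ε₀ := bigLam_pos (by linarith)
  have hΛk : 0 < bigLam ε₀ ^ k := zpow_pos hΛ k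
  have h1 : physEnergy ε₀ W k σ = ((bigLam ε₀ ^ k)⁻¹ * Real.exp σ * ‖W k σ‖) ^ 2 := by
    unfold physEnergy
    have : Real.exp (2 * σ) = Real.exp σ ^ 2 := by rw [sq, ← Real.exp_add]; ring_nf
    rw [this]; ring
  rw [h1, Real.sqrt_sq (by positivity), Real.exp_neg]
  field_simp

/-- `|F_k| ≤ 2 C_A Λ⁻¹ ‖W_{k+1}‖ E_k`.
[cite: Tao2016AveragedNS, §4 Lemma 4.1 (4.8)–(4.10) with the viscous equation displayed before Thm. 4.2, shell-wise in the self-similar variables of §6.4; cell lemma] -/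
theorem abs_physFlux_le {ε₀ : ℝ} (hε : 0 < ε₀) {α : Fin m → Fin m → Fin m → ℤ × ℤ × ℤ → ℝ}
    (hc : IsCancellingCoeff α) (W : ℤ → ℝ → Em m) (k : ℤ) (σ : ℝ) :
    |physFlux ε₀ α W k σ| ≤
      2 * fluxConst α * (bigLam ε₀)⁻¹ * ‖W (k + 1) σ‖ * physEnergy ε₀ W k σ := by
  have hS := table_sTable α hc
  have hΛ : 0 < bigLam ε₀ := bigLam_pos (by linarith)
  have hin : |⟪W (k + 1) σ, tableA α (W k σ)⟫| ≤ ‖W (k + 1) σ‖ * (fluxConst α * ‖W k σ‖ ^ 2) :=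
    (abs_real_inner_le_norm _ _).trans (mul_le_mul_of_nonneg_left (hS.normA _) (norm_nonneg _))
  have hc0 : 0 < 2 * ((bigLam ε₀ ^ k)⁻¹ ^ 2 * (bigLam ε₀)⁻¹) * Real.exp (2 * σ) := by
    have := zpow_pos hΛ k
    positivity
  have e : physFlux ε₀ α W k σ = (2 * ((bigLam ε₀ ^ k)⁻¹ ^ 2 * (bigLam ε₀)⁻¹) * Real.exp (2 * σ))
      * ⟪W (k + 1) σ, tableA α (W k σ)⟫ := by
    unfold physFlux; ring
  calc |physFlux ε₀ α W k σ|
      = 2 * ((bigLam ε₀ ^ k)⁻¹ ^ 2 * (bigLam ε₀)⁻¹) * Real.exp (2 * σ)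
          * |⟪W (k + 1) σ, tableA α (W k σ)⟫| := by
        rw [e, abs_mul, abs_of_pos hc0]
    _ ≤ 2 * ((bigLam ε₀ ^ k)⁻¹ ^ 2 * (bigLam ε₀)⁻¹) * Real.exp (2 * σ)
          * (‖W (k + 1) σ‖ * (fluxConst α * ‖W k σ‖ ^ 2)) :=
        mul_le_mul_of_nonneg_left hin hc0.le
    _ = 2 * fluxConst α * (bigLam ε₀)⁻¹ * ‖W (k + 1) σ‖ * physEnergy ε₀ W k σ := by
        unfold physEnergy; ring

/-! ### The finite tail: derivative, dissipation, far past -/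

/-- Energy balance of the finite tail `E_{N+1} + … + E_{N+M}`: incoming flux `F_N`, outgoing boundary flux `-F_{N+M}`, and the dissipation of each shell (the interior fluxes telescope).
[cite: Tao2016AveragedNS, §4 Lemma 4.1 (4.8)–(4.10) with the viscous equation displayed before Thm. 4.2, shell-wise in the self-similar variables of §6.4; cell lemma] -/
theorem hasDerivAt_tail {ε₀ νh : ℝ} {α : Fin m → Fin m → Fin m → ℤ × ℤ × ℤ → ℝ}
    {W : ℤ → ℝ → Em m} (hε : 0 < ε₀) (hW : IsEternalVisc ε₀ νh α W) (hc : IsCancellingCoeff α)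
    (N : ℤ) (M : ℕ) (σ : ℝ) :
    HasDerivAt (fun x => ∑ j ∈ Finset.range M, physEnergy ε₀ W (N + 1 + j) x)
      (physFlux ε₀ α W N σ - physFlux ε₀ α W (N + M) σ
        - ∑ j ∈ Finset.range M,
            2 * viscCoef ε₀ νh (N + 1 + j) σ * physEnergy ε₀ W (N + 1 + j) σ) σ := by
  have h := HasDerivAt.fun_sum (u := Finset.range M)
    (fun j _ => hasDerivAt_physEnergy hε hW hc (N + 1 + (j : ℤ)) σ)
  refine h.congr_deriv ?_
  rw [Finset.sum_sub_distrib]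
  congr 1
  have tele : ∀ M : ℕ, ∑ j ∈ Finset.range M,
      (physFlux ε₀ α W (N + 1 + (j : ℤ) - 1) σ - physFlux ε₀ α W (N + 1 + (j : ℤ)) σ)
      = physFlux ε₀ α W N σ - physFlux ε₀ α W (N + (M : ℤ)) σ := by
    intro M
    induction M with
    | zero => simp
    | succ M ih =>
      rw [Finset.sum_range_succ, ih]
      have e1 : N + 1 + ((M : ℕ) : ℤ) - 1 = N + (M : ℤ) := by ring
      have e2 : N + 1 + ((M : ℕ) : ℤ) = N + ((M + 1 : ℕ) : ℤ) := by push_cast; ring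
      rw [e1, e2]; ring
  exact tele M

/-- The dissipation of a finite tail is at least that of its lowest shell applied to the whole tail (the covariant viscosity coefficient increases with the shell index).
[cite: Tao2016AveragedNS, §4 Lemma 4.1 (4.8)–(4.10) with the viscous equation displayed before Thm. 4.2, shell-wise in the self-similar variables of §6.4; cell lemma] -/
theorem diss_ge {ε₀ νh : ℝ} (hε : 0 < ε₀) (hν : 0 ≤ νh) (W : ℤ → ℝ → Em m) (N : ℤ) (M : ℕ)
    (σ : ℝ) :
    viscCoef ε₀ νh (N + 1) σ * ∑ j ∈ Finset.range M, physEnergy ε₀ W (N + 1 + j) σ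
      ≤ ∑ j ∈ Finset.range M, viscCoef ε₀ νh (N + 1 + j) σ * physEnergy ε₀ W (N + 1 + j) σ := by
  rw [Finset.mul_sum]
  refine Finset.sum_le_sum fun j _ => ?_
  refine mul_le_mul_of_nonneg_right ?_ (physEnergy_nonneg _ _ _ _)
  unfold viscCoef
  refine mul_le_mul_of_nonneg_left ?_ hν
  refine mul_le_mul_of_nonneg_right ?_ (Real.exp_pos _).le
  refine Real.rpow_le_rpow_of_exponent_le (by linarith) ?_
  have : (0 : ℝ) ≤ (j : ℝ) := Nat.cast_nonneg j
  push_cast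
  linarith

/-- Under a uniform bound `‖W_k‖ ≤ C` above shell `n₀`, a finite tail of `M` physical energies above `N ≥ n₀` is `≤ M C² e^{2σ}` (hence tends to `0` in the far past).
[cite: Tao2016AveragedNS, §4 Lemma 4.1 (4.8)–(4.10) with the viscous equation displayed before Thm. 4.2, shell-wise in the self-similar variables of §6.4; cell lemma] -/
theorem tail_le_far {ε₀ : ℝ} (hε : 0 < ε₀) {W : ℤ → ℝ → Em m} {n₀ : ℕ} {C : ℝ}
    (hUB : ∀ k : ℤ, (n₀ : ℤ) < k → ∀ σ : ℝ, ‖W k σ‖ ≤ C) {N : ℤ} (hN : (n₀ : ℤ) ≤ N)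
    (M : ℕ) (σ : ℝ) :
    ∑ j ∈ Finset.range M, physEnergy ε₀ W (N + 1 + j) σ ≤ M * (Real.exp (2 * σ) * C ^ 2) := by
  have hΛ1 : 1 ≤ bigLam ε₀ := one_le_bigLam hε.le
  have hb : ∀ j ∈ Finset.range M, physEnergy ε₀ W (N + 1 + j) σ ≤ Real.exp (2 * σ) * C ^ 2 := by
    intro j _
    have hk : (n₀ : ℤ) < N + 1 + (j : ℤ) := by
      have : (0 : ℤ) ≤ (j : ℤ) := Int.natCast_nonneg j
      linarith
    have hWk := hUB _ hk σ
    have h1 : (bigLam ε₀ ^ (N + 1 + (j : ℤ)))⁻¹ ^ 2 ≤ 1 := by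
      have h1' : 1 ≤ bigLam ε₀ ^ (N + 1 + (j : ℤ)) := one_le_zpow₀ hΛ1 (by linarith)
      have h2' : (bigLam ε₀ ^ (N + 1 + (j : ℤ)))⁻¹ ≤ 1 := inv_le_one_of_one_le₀ h1'
      have h3' : 0 ≤ (bigLam ε₀ ^ (N + 1 + (j : ℤ)))⁻¹ := inv_nonneg.mpr (zero_le_one.trans h1')
      calc (bigLam ε₀ ^ (N + 1 + (j : ℤ)))⁻¹ ^ 2 ≤ 1 ^ 2 := pow_le_pow_left₀ h3' h2' 2
        _ = 1 := one_pow 2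
    have h2 : ‖W (N + 1 + j) σ‖ ^ 2 ≤ C ^ 2 := pow_le_pow_left₀ (norm_nonneg _) hWk 2
    unfold physEnergy
    calc (bigLam ε₀ ^ (N + 1 + (j : ℤ)))⁻¹ ^ 2 * (Real.exp (2 * σ) * ‖W (N + 1 + j) σ‖ ^ 2)
        ≤ 1 * (Real.exp (2 * σ) * C ^ 2) :=
          mul_le_mul h1 (mul_le_mul_of_nonneg_left h2 (Real.exp_pos _).le) (by positivity)
            zero_le_one
      _ = Real.exp (2 * σ) * C ^ 2 := one_mul _
  calc ∑ j ∈ Finset.range M, physEnergy ε₀ W (N + 1 + j) σ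
      ≤ ∑ _j ∈ Finset.range M, Real.exp (2 * σ) * C ^ 2 := Finset.sum_le_sum hb
    _ = M * (Real.exp (2 * σ) * C ^ 2) := by simp [Finset.sum_const, Finset.card_range]

/-- Choice of the tail length: the boundary weight `(Λ^{N+M})^{-2}` can be made as small as we please.
[cite: Tao2016AveragedNS, §4 (Λ = (1+ε₀)^{5/2}, the weights of Lemma 4.1); cell lemma] -/
theorem exists_tailLength {ε₀ : ℝ} (hε : 0 < ε₀) (G : ℝ) (hG : 0 ≤ G) (δ : ℝ) (hδ : 0 < δ)
    (N : ℤ) (hN : 0 ≤ N) :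
    ∃ M : ℕ, 1 ≤ M ∧ G * (bigLam ε₀ ^ (N + (M : ℤ)))⁻¹ ^ 2 ≤ δ := by
  have hΛ : 0 < bigLam ε₀ := bigLam_pos (by linarith)
  have hΛ1 : 1 < bigLam ε₀ := Real.one_lt_rpow (by linarith) (by norm_num)
  set q : ℝ := (bigLam ε₀ ^ 2)⁻¹ with hq
  have hq0 : 0 < q := by positivity
  have hq1 : q < 1 := inv_lt_one_of_one_lt₀ (by nlinarith)
  obtain ⟨M', hM'⟩ := exists_pow_lt_of_lt_one (div_pos hδ (by linarith : (0 : ℝ) < G + 1)) hq1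
  refine ⟨M' + 1, by omega, ?_⟩
  have hsplit : (bigLam ε₀ ^ (N + ((M' + 1 : ℕ) : ℤ)))⁻¹ ^ 2
      = (bigLam ε₀ ^ N)⁻¹ ^ 2 * q ^ (M' + 1) := by
    rw [zpow_add₀ hΛ.ne', zpow_natCast, hq]
    simp only [inv_pow]
    rw [← mul_inv]
    congr 1
    ring
  have hN1 : (bigLam ε₀ ^ N)⁻¹ ^ 2 ≤ 1 := by
    have h1' : 1 ≤ bigLam ε₀ ^ N := one_le_zpow₀ hΛ1.le hN
    have h2' : (bigLam ε₀ ^ N)⁻¹ ≤ 1 := inv_le_one_of_one_le₀ h1'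
    have h3' : 0 ≤ (bigLam ε₀ ^ N)⁻¹ := inv_nonneg.mpr (zero_le_one.trans h1')
    calc (bigLam ε₀ ^ N)⁻¹ ^ 2 ≤ 1 ^ 2 := pow_le_pow_left₀ h3' h2' 2
      _ = 1 := one_pow 2
  have hqM : q ^ (M' + 1) ≤ q ^ M' := pow_le_pow_of_le_one hq0.le hq1.le (Nat.le_succ _)
  have hG1 : G * (δ / (G + 1)) ≤ δ := by
    rw [mul_div_assoc']
    rw [div_le_iff₀ (by linarith)]
    nlinarith
  calc G * (bigLam ε₀ ^ (N + ((M' + 1 : ℕ) : ℤ)))⁻¹ ^ 2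
      = G * ((bigLam ε₀ ^ N)⁻¹ ^ 2 * q ^ (M' + 1)) := by rw [hsplit]
    _ ≤ G * (1 * q ^ M') := by
        refine mul_le_mul_of_nonneg_left ?_ hG
        exact mul_le_mul hN1 hqM (pow_nonneg hq0.le _) zero_le_one
    _ ≤ G * (δ / (G + 1)) := by
        rw [one_mul]; exact mul_le_mul_of_nonneg_left hM'.le hG
    _ ≤ δ := hG1


/-! ### Pure real lemmas: bracket, barrier, level limit -/

/-- PR1: above the barrier level `(a/b + √(δ/b))²` the bracket `a v + δ - b τ` is negative
whenever `0 ≤ v`, `v² ≤ τ`.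
[folklore] -/
private theorem bracket_neg {a b δ v τ : ℝ} (ha : 0 ≤ a) (hb : 0 < b) (hδ : 0 < δ) (hv : 0 ≤ v)
    (hvτ : v ^ 2 ≤ τ) (hτ : (a / b + Real.sqrt (δ / b)) ^ 2 < τ) : a * v + δ < b * τ := by
  set p := a / b with hp_def
  set q := Real.sqrt (δ / b) with hq_def
  have hp : 0 ≤ p := div_nonneg ha hb.le
  have hq : 0 < q := Real.sqrt_pos.mpr (div_pos hδ hb)
  have hq2 : q ^ 2 = δ / b := Real.sq_sqrt (div_pos hδ hb).le
  have hbq2 : b * q ^ 2 = δ := by rw [hq2]; field_simp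
  have hbp : b * p = a := by rw [hp_def]; field_simp
  have hτ0 : 0 ≤ τ := le_trans (sq_nonneg _) hvτ
  -- √τ > p + q
  have hsqrt : p + q < Real.sqrt τ := by
    rw [Real.lt_sqrt (by positivity)]
    exact hτ
  -- v ≤ √τ
  have hvs : v ≤ Real.sqrt τ := by
    rw [Real.le_sqrt hv hτ0]
    exact hvτ
  have hss : Real.sqrt τ * Real.sqrt τ = τ := Real.mul_self_sqrt hτ0
  have hs0 : 0 < Real.sqrt τ := lt_of_le_of_lt (add_nonneg hp hq.le) hsqrt
  -- b τ = (b √τ) √τ > b (p+q) √τ = a √τ + b q √τ ≥ a v + b q (p + q) ≥ a v + b q² = a v + δ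
  have h1 : b * (p + q) * Real.sqrt τ < b * τ := by
    have : b * (p + q) < b * Real.sqrt τ := mul_lt_mul_of_pos_left hsqrt hb
    calc b * (p + q) * Real.sqrt τ < b * Real.sqrt τ * Real.sqrt τ :=
          mul_lt_mul_of_pos_right this hs0
      _ = b * (Real.sqrt τ * Real.sqrt τ) := by ring
      _ = b * τ := by rw [hss]
  have h2 : a * v ≤ a * Real.sqrt τ := mul_le_mul_of_nonneg_left hvs ha
  have h3 : b * q * (p + q) ≤ b * q * Real.sqrt τ :=
    mul_le_mul_of_nonneg_left hsqrt.le (mul_nonneg hb.le hq.le)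
  have h4 : b * q ^ 2 ≤ b * q * (p + q) := by
    have : q ≤ p + q := le_add_of_nonneg_left hp
    calc b * q ^ 2 = b * q * q := by ring
      _ ≤ b * q * (p + q) := mul_le_mul_of_nonneg_left this (mul_nonneg hb.le hq.le)
  calc a * v + δ = a * v + b * q ^ 2 := by rw [hbq2]
    _ ≤ a * Real.sqrt τ + b * q * Real.sqrt τ := add_le_add h2 (h4.trans h3)
    _ = b * (p + q) * Real.sqrt τ := by rw [← hbp]; ring
    _ < b * τ := h1

/-- PR3: letting the boundary error `δ → 0⁺` in the barrier level.
[folklore] -/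
private theorem le_sq_of_forall_level {x p b : ℝ} (hp : 0 ≤ p) (hb : 0 < b)
    (h : ∀ δ : ℝ, 0 < δ → x ≤ (p + Real.sqrt (δ / b)) ^ 2) : x ≤ p ^ 2 := by
  by_contra hx
  push Not at hx
  have hx0 : 0 < x := lt_of_le_of_lt (sq_nonneg _) hx
  have hsx : p < Real.sqrt x := by
    rw [Real.lt_sqrt hp]; exact hx
  -- δ := b (√x - p)² / 4
  set r := Real.sqrt x - p with hr_def
  have hr : 0 < r := sub_pos.mpr hsx
  have hδ : 0 < b * (r / 2) ^ 2 := by positivity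
  have key := h (b * (r / 2) ^ 2) hδ
  have hsq : Real.sqrt (b * (r / 2) ^ 2 / b) = r / 2 := by
    rw [show b * (r / 2) ^ 2 / b = (r / 2) ^ 2 by field_simp]
    exact Real.sqrt_sq (by positivity)
  rw [hsq] at key
  -- p + r/2 < √x hence (p + r/2)^2 < x
  have hlt : p + r / 2 < Real.sqrt x := by rw [hr_def]; linarith
  have hnn : 0 ≤ p + r / 2 := by positivity
  have : (p + r / 2) ^ 2 < x := by
    rw [← Real.lt_sqrt hnn]; exact hlt
  linarith

/-- PR2 (barrier): a differentiable `g` which is `≤ L` in the far past and has negative derivative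
wherever it exceeds `L` (on `(-∞, σ₁]`) stays `≤ L` on `(-∞, σ₁]`.
[folklore] -/
private theorem pastBarrier {g g' : ℝ → ℝ} {L σ₁ : ℝ} (hg : ∀ x, HasDerivAt g (g' x) x)
    (hfar : ∃ σm : ℝ, ∀ σ, σ ≤ σm → g σ ≤ L)
    (hneg : ∀ σ, σ ≤ σ₁ → L < g σ → g' σ < 0) : ∀ σ, σ ≤ σ₁ → g σ ≤ L := by
  intro σ₂ hσ₂
  by_contra hcon
  push Not at hcon
  obtain ⟨σm, hσm⟩ := hfar
  have hlt : σm < σ₂ := by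
    by_contra h
    push Not at h
    exact absurd (hσm σ₂ h) (not_le.mpr hcon)
  have hgc : Continuous g := continuous_iff_continuousAt.mpr fun x => (hg x).continuousAt
  -- the last time before σ₂ at which g ≤ L
  set A : Set ℝ := Icc σm σ₂ ∩ g ⁻¹' (Iic L) with hA_def
  have hA_closed : IsClosed A := isClosed_Icc.inter (isClosed_Iic.preimage hgc)
  have hA_ne : A.Nonempty := ⟨σm, ⟨le_rfl, hlt.le⟩, hσm σm le_rfl⟩
  have hA_bdd : BddAbove A := ⟨σ₂, fun x hx => hx.1.2⟩
  set s := sSup A with hs_def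
  have hsA : s ∈ A := hA_closed.csSup_mem hA_ne hA_bdd
  have hgs : g s ≤ L := hsA.2
  have hs2 : s ≤ σ₂ := hsA.1.2
  have hs_ne : s ≠ σ₂ := by
    intro h; rw [h] at hgs; exact absurd hgs (not_le.mpr hcon)
  have hs_lt : s < σ₂ := lt_of_le_of_ne hs2 hs_ne
  -- on (s, σ₂) the function exceeds L, hence has negative derivative
  have habove : ∀ x ∈ Ioo s σ₂, L < g x := by
    intro x hx
    by_contra h
    push Not at h
    have hxA : x ∈ A := ⟨⟨hsA.1.1.trans hx.1.le, hx.2.le⟩, h⟩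
    exact absurd (le_csSup hA_bdd hxA) (not_le.mpr hx.1)
  -- mean value theorem on [s, σ₂]
  obtain ⟨ξ, hξ, hξeq⟩ := exists_hasDerivAt_eq_slope g g' hs_lt hgc.continuousOn
    (fun x _ => hg x)
  have hpos : 0 < (g σ₂ - g s) / (σ₂ - s) := div_pos (by linarith) (by linarith)
  have hneg' : g' ξ < 0 := hneg ξ (hξ.2.le.trans hσ₂) (habove ξ hξ)
  linarith


/-! ### The shell step: `E_{N+1} ≤ (C_A Λ^N S^E_N / (ν̂ (1+ε₀)^{2(N+1)}))²` -/

/-- **The shell step (past-local form).**  Under the type-I bound above `n₀` and for `N ≥ n₀`: if `E_N ≤ S^E` on `(-∞, σ₁]`, then, AT `σ₁`, `E_{N+1} ≤ (C_A Λ^N S^E/(ν̂ (1+ε₀)^{2(N+1)}))²` at all log-times (`ν̂ > 0`; finite-tail balance + barrier on `(-∞, σ₁]`, boundary error sent to `0` by the tail length).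
[cite: Tao2016AveragedNS, §4 Lemma 4.1 (4.8)–(4.10), Thm. 4.2 (statement shape), §6.4; cell theorem] -/
theorem physEnergy_succ_le_past {ε₀ νh : ℝ} {α : Fin m → Fin m → Fin m → ℤ × ℤ × ℤ → ℝ}
    {W : ℤ → ℝ → Em m} (hε : 0 < ε₀) (hν : 0 < νh) (hW : IsEternalVisc ε₀ νh α W)
    (hc : IsCancellingCoeff α) {n₀ : ℕ} {C : ℝ}
    (hUB : ∀ k : ℤ, (n₀ : ℤ) < k → ∀ σ : ℝ, ‖W k σ‖ ≤ C) {N : ℤ} (hN : (n₀ : ℤ) ≤ N)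
    {SE : ℝ} (hSE0 : 0 ≤ SE) (σ₁ : ℝ)
    (hSE : ∀ σ, σ ≤ σ₁ → physEnergy ε₀ W N σ ≤ SE) :
    physEnergy ε₀ W (N + 1) σ₁ ≤
      (fluxConst α * bigLam ε₀ ^ N * SE / (νh * (1 + ε₀) ^ ((2 : ℝ) * ((N + 1 : ℤ) : ℝ)))) ^ 2 := by
  have hΛ : 0 < bigLam ε₀ := bigLam_pos (by linarith)
  have hΛN : 0 < bigLam ε₀ ^ N := zpow_pos hΛ N
  have hCA0 : 0 ≤ fluxConst α := fluxConst_nonneg α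
  have hx : 0 < 1 + ε₀ := by linarith
  have hP : 0 < (1 + ε₀) ^ ((2 : ℝ) * ((N + 1 : ℤ) : ℝ)) := Real.rpow_pos_of_pos hx _
  obtain ⟨b, hb⟩ : ∃ b : ℝ, b = 2 * (νh * (1 + ε₀) ^ ((2 : ℝ) * ((N + 1 : ℤ) : ℝ))) := ⟨_, rfl⟩
  have hb0 : 0 < b := by rw [hb]; positivity
  obtain ⟨a, ha⟩ : ∃ a : ℝ, a = 2 * fluxConst α * bigLam ε₀ ^ N * SE := ⟨_, rfl⟩
  have ha0 : 0 ≤ a := by rw [ha]; positivity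
  have hN0 : 0 ≤ N := le_trans (Int.natCast_nonneg n₀) hN
  have hC : 0 ≤ C := (norm_nonneg _).trans (hUB (N + 1) (by linarith) 0)
  -- every boundary error δ > 0 gives the level (a/b + √(δ/b))²
  have key : ∀ δ : ℝ, 0 < δ → physEnergy ε₀ W (N + 1) σ₁ ≤ (a / b + Real.sqrt (δ / b)) ^ 2 := by
    intro δ hδ
    obtain ⟨M, hM1, hMδ⟩ := exists_tailLength hε
      (2 * fluxConst α * (bigLam ε₀)⁻¹ * C ^ 3 * Real.exp (3 * σ₁)) (by positivity) δ hδ N hN0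
    have hL0 : 0 < (a / b + Real.sqrt (δ / b)) ^ 2 := by
      have h1 : 0 < Real.sqrt (δ / b) := Real.sqrt_pos.mpr (div_pos hδ hb0)
      have h2 : 0 ≤ a / b := div_nonneg ha0 hb0.le
      positivity
    -- the finite tail τ(x) = Σ_{j<M} E_{N+1+j}(x) and its derivative
    have hderiv := fun x => hasDerivAt_tail hε hW hc N M x
    have hτ0 : ∀ x, 0 ≤ ∑ j ∈ Finset.range M, physEnergy ε₀ W (N + 1 + j) x :=
      fun x => Finset.sum_nonneg fun j _ => physEnergy_nonneg _ _ _ _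
    have hE1τ : ∀ x, physEnergy ε₀ W (N + 1) x ≤ ∑ j ∈ Finset.range M, physEnergy ε₀ W (N + 1 + j) x := by
      intro x
      have h := Finset.single_le_sum (s := Finset.range M)
        (f := fun j : ℕ => physEnergy ε₀ W (N + 1 + (j : ℤ)) x)
        (fun j _ => physEnergy_nonneg ε₀ W (N + 1 + (j : ℤ)) x) (Finset.mem_range.mpr hM1)
      simpa using h
    -- far past: the tail is below the level
    have hfar : ∃ σm : ℝ, ∀ σ, σ ≤ σm →
        ∑ j ∈ Finset.range M, physEnergy ε₀ W (N + 1 + j) σ ≤ (a / b + Real.sqrt (δ / b)) ^ 2 := by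
      set L := (a / b + Real.sqrt (δ / b)) ^ 2 with hL
      have hD : 0 < (M : ℝ) * C ^ 2 + 1 := by positivity
      refine ⟨Real.log (L / ((M : ℝ) * C ^ 2 + 1)) / 2, fun σ hσ => ?_⟩
      have h1 := tail_le_far hε hUB hN M σ
      have h2 : Real.exp (2 * σ) ≤ L / ((M : ℝ) * C ^ 2 + 1) := by
        have : 2 * σ ≤ Real.log (L / ((M : ℝ) * C ^ 2 + 1)) := by linarith
        calc Real.exp (2 * σ) ≤ Real.exp (Real.log (L / ((M : ℝ) * C ^ 2 + 1))) :=
              Real.exp_le_exp.mpr this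
          _ = L / ((M : ℝ) * C ^ 2 + 1) := Real.exp_log (div_pos hL0 hD)
      calc ∑ j ∈ Finset.range M, physEnergy ε₀ W (N + 1 + j) σ
          ≤ M * (Real.exp (2 * σ) * C ^ 2) := h1
        _ = ((M : ℝ) * C ^ 2) * Real.exp (2 * σ) := by ring
        _ ≤ ((M : ℝ) * C ^ 2) * (L / ((M : ℝ) * C ^ 2 + 1)) :=
            mul_le_mul_of_nonneg_left h2 (by positivity)
        _ ≤ ((M : ℝ) * C ^ 2 + 1) * (L / ((M : ℝ) * C ^ 2 + 1)) :=
            mul_le_mul_of_nonneg_right (by linarith) (div_nonneg hL0.le hD.le)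
        _ = L := mul_div_cancel₀ L hD.ne'
    -- above the level the tail strictly decreases (on (-∞, σ₁])
    have hneg : ∀ σ, σ ≤ σ₁ →
        (a / b + Real.sqrt (δ / b)) ^ 2 < ∑ j ∈ Finset.range M, physEnergy ε₀ W (N + 1 + j) σ →
        physFlux ε₀ α W N σ - physFlux ε₀ α W (N + M) σ
          - ∑ j ∈ Finset.range M,
              2 * viscCoef ε₀ νh (N + 1 + j) σ * physEnergy ε₀ W (N + 1 + j) σ < 0 := by
      intro σ hσ hLτ
      have hexp : 0 < Real.exp (-σ) := Real.exp_pos _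
      -- incoming flux
      have hin : |physFlux ε₀ α W N σ| ≤ Real.exp (-σ) *
          (a * Real.sqrt (∑ j ∈ Finset.range M, physEnergy ε₀ W (N + 1 + j) σ)) := by
        have hφ := abs_physFlux_le hε hc W N σ
        have hnorm := norm_eq_sqrt_physEnergy hε W (N + 1) σ
        have hsq : Real.sqrt (physEnergy ε₀ W (N + 1) σ)
            ≤ Real.sqrt (∑ j ∈ Finset.range M, physEnergy ε₀ W (N + 1 + j) σ) :=
          Real.sqrt_le_sqrt (hE1τ σ)
        have hzp : (bigLam ε₀)⁻¹ * bigLam ε₀ ^ (N + 1) = bigLam ε₀ ^ N := by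
          rw [zpow_add_one₀ hΛ.ne']; field_simp
        calc |physFlux ε₀ α W N σ|
            ≤ 2 * fluxConst α * (bigLam ε₀)⁻¹ * ‖W (N + 1) σ‖ * physEnergy ε₀ W N σ := hφ
          _ = Real.exp (-σ) * (2 * fluxConst α * ((bigLam ε₀)⁻¹ * bigLam ε₀ ^ (N + 1)) *
                (physEnergy ε₀ W N σ * Real.sqrt (physEnergy ε₀ W (N + 1) σ))) := by
              rw [hnorm]; ring
          _ ≤ Real.exp (-σ) * (2 * fluxConst α * ((bigLam ε₀)⁻¹ * bigLam ε₀ ^ (N + 1)) *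
                (SE * Real.sqrt (∑ j ∈ Finset.range M, physEnergy ε₀ W (N + 1 + j) σ))) := by
              rw [hzp]
              refine mul_le_mul_of_nonneg_left ?_ hexp.le
              refine mul_le_mul_of_nonneg_left ?_ (by positivity)
              exact mul_le_mul (hSE σ hσ) hsq (Real.sqrt_nonneg _) hSE0
          _ = Real.exp (-σ) * (a * Real.sqrt (∑ j ∈ Finset.range M, physEnergy ε₀ W (N + 1 + j) σ)) := by
              rw [hzp, ha]; ring
      -- outgoing (boundary) flux
      have hout : |physFlux ε₀ α W (N + M) σ| ≤ Real.exp (-σ) * δ := by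
        have hWb1 : ‖W (N + M + 1) σ‖ ≤ C := hUB _ (by linarith) σ
        have hWb0 : ‖W (N + M) σ‖ ≤ C := hUB _ (by linarith) σ
        have hEb : physEnergy ε₀ W (N + M) σ
            ≤ (bigLam ε₀ ^ (N + (M : ℤ)))⁻¹ ^ 2 * (Real.exp (2 * σ) * C ^ 2) := by
          unfold physEnergy
          have h2 : ‖W (N + M) σ‖ ^ 2 ≤ C ^ 2 := pow_le_pow_left₀ (norm_nonneg _) hWb0 2
          have h3 : 0 ≤ (bigLam ε₀ ^ (N + (M : ℤ)))⁻¹ ^ 2 := by positivity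
          exact mul_le_mul_of_nonneg_left (mul_le_mul_of_nonneg_left h2 (Real.exp_pos _).le) h3
        have he : Real.exp (2 * σ) = Real.exp (-σ) * Real.exp (3 * σ) := by
          rw [← Real.exp_add]; ring_nf
        have he3 : Real.exp (3 * σ) ≤ Real.exp (3 * σ₁) := Real.exp_le_exp.mpr (by linarith)
        have hk0 : 0 ≤ 2 * fluxConst α * (bigLam ε₀)⁻¹ := by positivity
        calc |physFlux ε₀ α W (N + M) σ|
            ≤ 2 * fluxConst α * (bigLam ε₀)⁻¹ * ‖W (N + M + 1) σ‖ * physEnergy ε₀ W (N + M) σ :=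
              abs_physFlux_le hε hc W (N + M) σ
          _ ≤ 2 * fluxConst α * (bigLam ε₀)⁻¹ * C *
                ((bigLam ε₀ ^ (N + (M : ℤ)))⁻¹ ^ 2 * (Real.exp (2 * σ) * C ^ 2)) :=
              mul_le_mul (mul_le_mul_of_nonneg_left hWb1 hk0) hEb (physEnergy_nonneg _ _ _ _)
                (mul_nonneg hk0 hC)
          _ = Real.exp (-σ) * ((2 * fluxConst α * (bigLam ε₀)⁻¹ * C ^ 3 * Real.exp (3 * σ)) *
                (bigLam ε₀ ^ (N + (M : ℤ)))⁻¹ ^ 2) := by rw [he]; ring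
          _ ≤ Real.exp (-σ) * ((2 * fluxConst α * (bigLam ε₀)⁻¹ * C ^ 3 * Real.exp (3 * σ₁)) *
                (bigLam ε₀ ^ (N + (M : ℤ)))⁻¹ ^ 2) := by
              refine mul_le_mul_of_nonneg_left ?_ hexp.le
              refine mul_le_mul_of_nonneg_right ?_ (by positivity)
              exact mul_le_mul_of_nonneg_left he3 (by positivity)
          _ ≤ Real.exp (-σ) * δ := mul_le_mul_of_nonneg_left hMδ hexp.le
      -- dissipation of the tail is at least that of its lowest shell
      have hdiss : Real.exp (-σ) * (b * ∑ j ∈ Finset.range M, physEnergy ε₀ W (N + 1 + j) σ)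
          ≤ ∑ j ∈ Finset.range M,
              2 * viscCoef ε₀ νh (N + 1 + j) σ * physEnergy ε₀ W (N + 1 + j) σ := by
        have h := diss_ge hε hν.le W N M σ
        have e : Real.exp (-σ) * (b * ∑ j ∈ Finset.range M, physEnergy ε₀ W (N + 1 + j) σ)
            = 2 * (viscCoef ε₀ νh (N + 1) σ *
                ∑ j ∈ Finset.range M, physEnergy ε₀ W (N + 1 + j) σ) := by
          rw [hb]; unfold viscCoef; push_cast; ring
        rw [e]
        calc 2 * (viscCoef ε₀ νh (N + 1) σ * ∑ j ∈ Finset.range M, physEnergy ε₀ W (N + 1 + j) σ)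
            ≤ 2 * ∑ j ∈ Finset.range M,
                viscCoef ε₀ νh (N + 1 + j) σ * physEnergy ε₀ W (N + 1 + j) σ := by linarith
          _ = ∑ j ∈ Finset.range M,
                2 * viscCoef ε₀ νh (N + 1 + j) σ * physEnergy ε₀ W (N + 1 + j) σ := by
              rw [Finset.mul_sum]
              exact Finset.sum_congr rfl fun j _ => by ring
      -- the bracket is negative above the level
      have hbr := bracket_neg ha0 hb0 hδ (Real.sqrt_nonneg _)
        (le_of_eq (Real.sq_sqrt (hτ0 σ))) hLτ
      have h1 := le_abs_self (physFlux ε₀ α W N σ)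
      have h2 := neg_abs_le (physFlux ε₀ α W (N + M) σ)
      have h3 : Real.exp (-σ) * (a * Real.sqrt (∑ j ∈ Finset.range M, physEnergy ε₀ W (N + 1 + j) σ))
          + Real.exp (-σ) * δ
          - Real.exp (-σ) * (b * ∑ j ∈ Finset.range M, physEnergy ε₀ W (N + 1 + j) σ) < 0 := by
        have : Real.exp (-σ) * (a * Real.sqrt (∑ j ∈ Finset.range M, physEnergy ε₀ W (N + 1 + j) σ)
            + δ - b * ∑ j ∈ Finset.range M, physEnergy ε₀ W (N + 1 + j) σ) < 0 :=
          mul_neg_of_pos_of_neg hexp (by linarith)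
        linarith
      linarith
    have hbar := pastBarrier hderiv hfar hneg σ₁ le_rfl
    exact (hE1τ σ₁).trans hbar
  have hfin := le_sq_of_forall_level (div_nonneg ha0 hb0.le) hb0 key
  have hab : a / b = fluxConst α * bigLam ε₀ ^ N * SE /
      (νh * (1 + ε₀) ^ ((2 : ℝ) * ((N + 1 : ℤ) : ℝ))) := by
    rw [ha, hb, show 2 * fluxConst α * bigLam ε₀ ^ N * SE = 2 * (fluxConst α * bigLam ε₀ ^ N * SE) by ring,
      mul_div_mul_left _ _ (two_ne_zero)]
  rw [hab] at hfin
  exact hfin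


/-- **The shell step.**  Under the type-I bound above `n₀` and for `N ≥ n₀`: if `E_N ≤ S^E` at all log-times, then `E_{N+1} ≤ (C_A Λ^N S^E/(ν̂ (1+ε₀)^{2(N+1)}))²` at all log-times (`ν̂ > 0`) — the global corollary of `physEnergy_succ_le_past`.
[cite: Tao2016AveragedNS, §4 Lemma 4.1 (4.8)–(4.10), Thm. 4.2 (statement shape), §6.4; cell theorem] -/
theorem physEnergy_succ_le {ε₀ νh : ℝ} {α : Fin m → Fin m → Fin m → ℤ × ℤ × ℤ → ℝ}
    {W : ℤ → ℝ → Em m} (hε : 0 < ε₀) (hν : 0 < νh) (hW : IsEternalVisc ε₀ νh α W)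
    (hc : IsCancellingCoeff α) {n₀ : ℕ} {C : ℝ}
    (hUB : ∀ k : ℤ, (n₀ : ℤ) < k → ∀ σ : ℝ, ‖W k σ‖ ≤ C) {N : ℤ} (hN : (n₀ : ℤ) ≤ N)
    {SE : ℝ} (hSE0 : 0 ≤ SE) (hSE : ∀ σ, physEnergy ε₀ W N σ ≤ SE) (σ₁ : ℝ) :
    physEnergy ε₀ W (N + 1) σ₁ ≤
      (fluxConst α * bigLam ε₀ ^ N * SE / (νh * (1 + ε₀) ^ ((2 : ℝ) * ((N + 1 : ℤ) : ℝ)))) ^ 2 :=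
  physEnergy_succ_le_past hε hν hW hc hUB hN hSE0 σ₁ fun σ _ => hSE σ

/-! ### Dissipation-range decay of bounded viscous eternal solutions -/

/-- **Dissipation-range / far-past decay.**  An admissible viscous eternal solution (`ν̂ > 0`,
cancelling table, `ε₀ > 0`) with the uniform bound `‖W_k(σ)‖ ≤ B` obeys, on every shell `k ≥ 1`
and at every log-time `σ`,  `‖W_k(σ)‖ ≤ C_A Λ B² e^{σ} / (ν̂ (1+ε₀)^{2k})`: it is exponentially
small in the far past on every shell (rate `e^{σ}`) and geometrically small above the dissipation
cutoff `k_d(σ)` given by `(1+ε₀)^{2k_d} = C_A Λ B e^{σ}/ν̂` (`‖W_k(σ)‖ ≤ B (1+ε₀)^{-2(k-k_d)}`).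
Proof: the past-local shell step with `E_{k-1} ≤ Λ^{-2(k-1)} B² e^{2σ₁}` on `(-∞, σ₁]`.
[cite: Tao2016AveragedNS, §4 Lemma 4.1 (4.8)–(4.10), Thm. 4.2 (statement shape), §6.4; cell theorem] -/
theorem farPastDecay {ε₀ νh : ℝ} {α : Fin m → Fin m → Fin m → ℤ × ℤ × ℤ → ℝ}
    {W : ℤ → ℝ → Em m} (hε : 0 < ε₀) (hν : 0 < νh) (hW : IsEternalVisc ε₀ νh α W)
    (hc : IsCancellingCoeff α) {B : ℝ} (hB : ∀ (k : ℤ) (σ : ℝ), ‖W k σ‖ ≤ B)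
    {k : ℤ} (hk : 1 ≤ k) (σ₁ : ℝ) :
    ‖W k σ₁‖ ≤ fluxConst α * bigLam ε₀ * B ^ 2 * Real.exp σ₁
      / (νh * (1 + ε₀) ^ ((2 : ℝ) * (k : ℝ))) := by
  have hΛ : 0 < bigLam ε₀ := bigLam_pos (by linarith)
  have hx : 0 < 1 + ε₀ := by linarith
  have hCA0 : 0 ≤ fluxConst α := fluxConst_nonneg α
  have hB0 : 0 ≤ B := (norm_nonneg _).trans (hB 0 0)
  -- the shell below
  obtain ⟨N, rfl⟩ : ∃ N : ℤ, k = N + 1 := ⟨k - 1, by ring⟩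
  have hN : ((0 : ℕ) : ℤ) ≤ N := by push_cast; linarith
  have hΛN : 0 < bigLam ε₀ ^ N := zpow_pos hΛ N
  have hUB : ∀ j : ℤ, ((0 : ℕ) : ℤ) < j → ∀ σ : ℝ, ‖W j σ‖ ≤ B := fun j _ σ => hB j σ
  -- past-local ceiling of shell N on (-∞, σ₁]
  set SE : ℝ := (bigLam ε₀ ^ N)⁻¹ ^ 2 * (Real.exp (2 * σ₁) * B ^ 2) with hSE_def
  have hSE0 : 0 ≤ SE := by positivity
  have hSE : ∀ σ, σ ≤ σ₁ → physEnergy ε₀ W N σ ≤ SE := by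
    intro σ hσ
    unfold physEnergy
    have h1 : Real.exp (2 * σ) ≤ Real.exp (2 * σ₁) := Real.exp_le_exp.mpr (by linarith)
    have h2 : ‖W N σ‖ ^ 2 ≤ B ^ 2 := pow_le_pow_left₀ (norm_nonneg _) (hB N σ) 2
    have h3 : Real.exp (2 * σ) * ‖W N σ‖ ^ 2 ≤ Real.exp (2 * σ₁) * B ^ 2 :=
      mul_le_mul h1 h2 (by positivity) (Real.exp_pos _).le
    exact mul_le_mul_of_nonneg_left h3 (by positivity)
  have hstep := physEnergy_succ_le_past hε hν hW hc hUB hN hSE0 σ₁ hSE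
  -- translate the energy bound into an amplitude bound
  have hP : 0 < (1 + ε₀) ^ ((2 : ℝ) * (((N + 1 : ℤ) : ℝ))) := Real.rpow_pos_of_pos hx _
  set X : ℝ := fluxConst α * bigLam ε₀ * B ^ 2 * Real.exp σ₁
      / (νh * (1 + ε₀) ^ ((2 : ℝ) * (((N + 1 : ℤ) : ℝ)))) with hX_def
  have hX0 : 0 ≤ X := by positivity
  have hexp2 : Real.exp (2 * σ₁) = Real.exp σ₁ ^ 2 := by
    rw [sq, ← Real.exp_add]; ring_nf
  have hΛN1 : bigLam ε₀ ^ (N + 1) = bigLam ε₀ ^ N * bigLam ε₀ := zpow_add_one₀ hΛ.ne' N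
  -- E_{N+1}(σ₁) = Λ^{-2(N+1)} e^{2σ₁} ‖W_{N+1}(σ₁)‖²  and  Λ^{-2(N+1)} e^{2σ₁} X² = (step bound)
  have hid : (bigLam ε₀ ^ (N + 1))⁻¹ ^ 2 * (Real.exp (2 * σ₁) * X ^ 2)
      = (fluxConst α * bigLam ε₀ ^ N * SE / (νh * (1 + ε₀) ^ ((2 : ℝ) * (((N + 1 : ℤ) : ℝ))))) ^ 2 := by
    rw [hX_def, hSE_def, hΛN1, hexp2]
    field_simp
  have hE : (bigLam ε₀ ^ (N + 1))⁻¹ ^ 2 * (Real.exp (2 * σ₁) * ‖W (N + 1) σ₁‖ ^ 2)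
      ≤ (bigLam ε₀ ^ (N + 1))⁻¹ ^ 2 * (Real.exp (2 * σ₁) * X ^ 2) := by
    rw [hid]; exact hstep
  have hw : 0 < (bigLam ε₀ ^ (N + 1))⁻¹ ^ 2 * Real.exp (2 * σ₁) := by positivity
  have hsq : ‖W (N + 1) σ₁‖ ^ 2 ≤ X ^ 2 := by
    have := hE
    rw [← mul_assoc, ← mul_assoc] at this
    exact le_of_mul_le_mul_left this hw
  calc ‖W (N + 1) σ₁‖ ≤ X := (pow_le_pow_iff_left₀ (norm_nonneg _) hX0 two_ne_zero).1 hsq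
    _ = _ := by rw [hX_def]

/-! ### Shift symmetry of the viscous lattice and the all-shells form -/

/-- **Shift symmetry of `IsEternalVisc`.**  The covariant viscosity `ν̂ (1+ε₀)^{2n} e^{-σ}` is
invariant under `(n, σ) ↦ (n + d, σ + 2d·log(1+ε₀))`, and the inviscid part of the law is
autonomous and shell-homogeneous; the admissibility clauses are translation invariant.  Hence
`W̃_n(σ) := W_{n+d}(σ + 2d log(1+ε₀))` is again an admissible viscous eternal solution with the
same `ν̂`.
[cite: Tao2016AveragedNS, §4, the viscous equation displayed before Thm. 4.2 and Lemma 4.1 (iii) (4.8), written shell-wise in the self-similar variables of §6.4; cell lemma] -/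
theorem isEternalVisc_shift {ε₀ νh : ℝ} {α : Fin m → Fin m → Fin m → ℤ × ℤ × ℤ → ℝ}
    {W : ℤ → ℝ → Em m} (hε : -1 < ε₀) (hW : IsEternalVisc ε₀ νh α W) (d : ℤ) :
    IsEternalVisc ε₀ νh α (fun n σ => W (n + d) (σ + 2 * (d : ℝ) * Real.log (1 + ε₀))) := by
  set s : ℝ := 2 * (d : ℝ) * Real.log (1 + ε₀) with hs
  have hx : 0 < 1 + ε₀ := by linarith
  refine ⟨fun n σ => ?_, hW.nonneg, ?_, fun n => ?_⟩
  · -- the law: chain rule for the translation, then the coefficient identity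
    have h := HasDerivAt.comp_add_const σ s (hW.law (n + d) (σ + s))
    have hcoef : νh * ((1 + ε₀) ^ ((2 : ℝ) * ((n + d : ℤ) : ℝ)) * Real.exp (-(σ + s)))
        = νh * ((1 + ε₀) ^ ((2 : ℝ) * (n : ℝ)) * Real.exp (-σ)) := by
      have h1 : (1 + ε₀) ^ ((2 : ℝ) * ((n + d : ℤ) : ℝ))
          = (1 + ε₀) ^ ((2 : ℝ) * (n : ℝ)) * (1 + ε₀) ^ ((2 : ℝ) * (d : ℝ)) := by
        push_cast
        rw [mul_add, Real.rpow_add hx]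
      have h2 : (1 + ε₀) ^ ((2 : ℝ) * (d : ℝ)) * Real.exp (-s) = 1 := by
        rw [Real.rpow_def_of_pos hx, ← Real.exp_add, hs]
        convert Real.exp_zero using 2
        ring
      rw [h1, neg_add, Real.exp_add]
      calc νh * ((1 + ε₀) ^ ((2 : ℝ) * (n : ℝ)) * (1 + ε₀) ^ ((2 : ℝ) * (d : ℝ))
            * (Real.exp (-σ) * Real.exp (-s)))
          = νh * ((1 + ε₀) ^ ((2 : ℝ) * (n : ℝ)) * Real.exp (-σ))
            * ((1 + ε₀) ^ ((2 : ℝ) * (d : ℝ)) * Real.exp (-s)) := by ring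
        _ = νh * ((1 + ε₀) ^ ((2 : ℝ) * (n : ℝ)) * Real.exp (-σ)) := by rw [h2, mul_one]
    have e1 : n + d - 1 = n - 1 + d := by ring
    have e2 : n + d + 1 = n + 1 + d := by ring
    rw [hcoef, e1, e2] at h
    exact h
  · -- uniform action bound: translation invariance of the Lebesgue integral
    obtain ⟨M, hM⟩ := hW.action
    refine ⟨M, fun n => ⟨?_, ?_⟩⟩
    · exact (hM (n + d)).1.comp_add_right s
    · have : ∫ σ, ‖W (n + d) (σ + s)‖ = ∫ σ, ‖W (n + d) σ‖ :=
        MeasureTheory.integral_add_right_eq_self (fun σ => ‖W (n + d) σ‖) s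
      rw [this]
      exact (hM (n + d)).2
  · -- forward bound on the renormalised energy
    obtain ⟨σ₀, P, hP⟩ := hW.bdd (n + d)
    refine ⟨σ₀ - s, Real.exp (-(2 * s)) * P, fun σ hσ => ?_⟩
    have hσ' : σ₀ ≤ σ + s := by linarith
    have h := hP (σ + s) hσ'
    have hexp : Real.exp (2 * σ) = Real.exp (-(2 * s)) * Real.exp (2 * (σ + s)) := by
      rw [← Real.exp_add]; ring_nf
    rw [hexp, mul_assoc]
    exact mul_le_mul_of_nonneg_left h (Real.exp_pos _).le

/-- **Dissipation-range / far-past decay on EVERY shell.**  For an admissible viscous eternal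
solution (`ν̂ > 0`, cancelling table, `ε₀ > 0`) with `‖W_k(σ)‖ ≤ B` for all `k, σ`:
`‖W_k(σ)‖ ≤ C_A Λ B² e^{σ}/(ν̂ (1+ε₀)^{2k})` for EVERY `k ∈ ℤ` and every `σ` (the case `k ≥ 1`
transported by the shift symmetry `isEternalVisc_shift`).
[cite: Tao2016AveragedNS, §4 Lemma 4.1 (4.8)–(4.10), Thm. 4.2 (statement shape), §6.4; cell theorem] -/
theorem farPastDecay_all {ε₀ νh : ℝ} {α : Fin m → Fin m → Fin m → ℤ × ℤ × ℤ → ℝ}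
    {W : ℤ → ℝ → Em m} (hε : 0 < ε₀) (hν : 0 < νh) (hW : IsEternalVisc ε₀ νh α W)
    (hc : IsCancellingCoeff α) {B : ℝ} (hB : ∀ (k : ℤ) (σ : ℝ), ‖W k σ‖ ≤ B)
    (k : ℤ) (σ₁ : ℝ) :
    ‖W k σ₁‖ ≤ fluxConst α * bigLam ε₀ * B ^ 2 * Real.exp σ₁
      / (νh * (1 + ε₀) ^ ((2 : ℝ) * (k : ℝ))) := by
  have hx : 0 < 1 + ε₀ := by linarith
  -- shift by d = k - 1 so that shell k becomes shell 1
  set d : ℤ := k - 1 with hd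
  set s : ℝ := 2 * (d : ℝ) * Real.log (1 + ε₀) with hs
  have hWs := isEternalVisc_shift (by linarith : -1 < ε₀) hW d
  have hBs : ∀ (j : ℤ) (σ : ℝ), ‖(fun n σ => W (n + d) (σ + 2 * (d : ℝ) * Real.log (1 + ε₀))) j σ‖ ≤ B :=
    fun j σ => hB _ _
  have h := farPastDecay hε hν hWs hc hBs (le_refl (1 : ℤ)) (σ₁ - s)
  -- unfold the shifted solution at shell 1, time σ₁ - s
  have e1 : (1 : ℤ) + d = k := by rw [hd]; ring
  have e2 : σ₁ - s + 2 * (d : ℝ) * Real.log (1 + ε₀) = σ₁ := by rw [hs]; ring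
  simp only [e1, e2] at h
  -- compare the two right-hand sides: e^{σ₁ - s}/(1+ε₀)^2 = e^{σ₁}/(1+ε₀)^{2k}
  have hpow : Real.exp (σ₁ - s) / (νh * (1 + ε₀) ^ ((2 : ℝ) * ((1 : ℤ) : ℝ)))
      = Real.exp σ₁ / (νh * (1 + ε₀) ^ ((2 : ℝ) * (k : ℝ))) := by
    have hk : (k : ℝ) = (d : ℝ) + 1 := by rw [hd]; push_cast; ring
    rw [hk, Real.exp_sub, hs]
    have h3 : Real.exp (2 * (d : ℝ) * Real.log (1 + ε₀)) = (1 + ε₀) ^ ((2 : ℝ) * (d : ℝ)) := by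
      rw [Real.rpow_def_of_pos hx]; ring_nf
    rw [h3, show (2 : ℝ) * ((d : ℝ) + 1) = 2 * (d : ℝ) + 2 * ((1 : ℤ) : ℝ) by push_cast; ring,
      Real.rpow_add hx]
    have hp1 : 0 < (1 + ε₀) ^ ((2 : ℝ) * (d : ℝ)) := Real.rpow_pos_of_pos hx _
    have hp2 : 0 < (1 + ε₀) ^ ((2 : ℝ) * ((1 : ℤ) : ℝ)) := Real.rpow_pos_of_pos hx _
    field_simp
  calc ‖W k σ₁‖ ≤ fluxConst α * bigLam ε₀ * B ^ 2 * Real.exp (σ₁ - s)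
        / (νh * (1 + ε₀) ^ ((2 : ℝ) * ((1 : ℤ) : ℝ))) := h
    _ = fluxConst α * bigLam ε₀ * B ^ 2 * (Real.exp (σ₁ - s)
        / (νh * (1 + ε₀) ^ ((2 : ℝ) * ((1 : ℤ) : ℝ)))) := by ring
    _ = fluxConst α * bigLam ε₀ * B ^ 2 * (Real.exp σ₁
        / (νh * (1 + ε₀) ^ ((2 : ℝ) * (k : ℝ)))) := by rw [hpow]
    _ = _ := by ring

/-! ### Weights and exponents -/

/-- `Λ² = (1+ε₀)^5`.
[cite: Tao2016AveragedNS, §4 (Λ = (1+ε₀)^{5/2}, the weights of Lemma 4.1); cell lemma] -/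
theorem bigLam_sq {ε₀ : ℝ} (hε : 0 ≤ ε₀) : bigLam ε₀ ^ 2 = (1 + ε₀) ^ 5 := by
  unfold bigLam
  rw [← Real.rpow_two, ← Real.rpow_mul (by linarith),
    show ((5 : ℝ) / 2 * 2) = ((5 : ℕ) : ℝ) by norm_num, Real.rpow_natCast]

/-- `p_n = (1+ε₀)^n E_n`.
[cite: Tao2016AveragedNS, §4 Lemma 4.1 (4.8)–(4.10) with the viscous equation displayed before Thm. 4.2, shell-wise in the self-similar variables of §6.4; cell lemma] -/
theorem wtEnergy_eq {ε₀ : ℝ} (hε : 0 < ε₀) (W : ℤ → ℝ → Em m) (n : ℕ) (σ : ℝ) :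
    wtEnergy ε₀ W n σ = (1 + ε₀) ^ n * physEnergy ε₀ W n σ := by
  have hx : 0 < 1 + ε₀ := by linarith
  have h1 : (bigLam ε₀ ^ (n : ℤ))⁻¹ ^ 2 = (((1 + ε₀) ^ 5) ^ n)⁻¹ := by
    rw [zpow_natCast, inv_pow, ← pow_mul, mul_comm, pow_mul, bigLam_sq hε.le]
  have h2 : physWeight 1 ε₀ ^ n = (1 + ε₀) ^ n * (((1 + ε₀) ^ 5) ^ n)⁻¹ := by
    unfold physWeight
    rw [Real.rpow_one, div_pow, div_eq_mul_inv]
  unfold wtEnergy physEnergy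
  rw [h1, h2]
  ring

/-- Real-power bookkeeping: `(1+ε₀)^{2(n+1)}` as a natural power.
[folklore] -/
private theorem rpow_two_mul_succ {ε₀ : ℝ} (n : ℕ) :
    (1 + ε₀) ^ ((2 : ℝ) * ((((n : ℤ) + 1 : ℤ)) : ℝ)) = (1 + ε₀) ^ (2 * (n + 1)) := by
  rw [show ((2 : ℝ) * ((((n : ℤ) + 1 : ℤ)) : ℝ)) = ((2 * (n + 1) : ℕ) : ℝ) by push_cast; ring,
    Real.rpow_natCast]

/-- The weight bookkeeping of one step (`x = 1+ε₀ ≥ 1`, `Λn² = x^{5n}`):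
`x^{n+1} (C_A Λn (T/x^n) / (ν̂ x^{2(n+1)}))² = C_A² T² x^{-3} / ν̂² ≤ 4096 T²/ν̂²`.
[folklore] -/
private theorem weight_step {x CA νh T Λn : ℝ} {n : ℕ} (hx1 : 1 ≤ x) (hν : 0 < νh) (hCA0 : 0 ≤ CA)
    (hCA : CA ≤ 64) (hΛ : Λn ^ 2 = x ^ (5 * n)) :
    x ^ (n + 1) * (CA * Λn * (T / x ^ n) / (νh * x ^ (2 * (n + 1)))) ^ 2
      ≤ 4096 / νh ^ 2 * T ^ 2 := by
  have hx : 0 < x := by linarith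
  have e : x ^ (n + 1) * (CA * Λn * (T / x ^ n) / (νh * x ^ (2 * (n + 1)))) ^ 2
      = CA ^ 2 / νh ^ 2 * T ^ 2 * (x ^ (6 * n + 1) / x ^ (6 * n + 4)) := by
    rw [div_pow, mul_pow, mul_pow, hΛ]
    field_simp
    ring
  rw [e]
  have hr : x ^ (6 * n + 1) / x ^ (6 * n + 4) ≤ 1 := by
    rw [div_le_one (by positivity)]
    exact pow_le_pow_right₀ hx1 (by omega)
  have hCA2 : CA ^ 2 ≤ 4096 := by nlinarith
  calc CA ^ 2 / νh ^ 2 * T ^ 2 * (x ^ (6 * n + 1) / x ^ (6 * n + 4))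
      ≤ CA ^ 2 / νh ^ 2 * T ^ 2 * 1 := mul_le_mul_of_nonneg_left hr (by positivity)
    _ ≤ 4096 / νh ^ 2 * T ^ 2 := by
        rw [mul_one]
        exact mul_le_mul_of_nonneg_right (div_le_div_of_nonneg_right hCA2 (by positivity))
          (sq_nonneg _)

/-- `(Λ^n)² = (1+ε₀)^{5n}`.
[cite: Tao2016AveragedNS, §4 (Λ = (1+ε₀)^{5/2}, the weights of Lemma 4.1); cell lemma] -/
theorem bigLam_pow_sq {ε₀ : ℝ} (hε : 0 ≤ ε₀) (n : ℕ) : (bigLam ε₀ ^ n) ^ 2 = (1 + ε₀) ^ (5 * n) := by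
  rw [← pow_mul, mul_comm, pow_mul, bigLam_sq hε]
  exact (pow_mul (1 + ε₀) 5 n).symm

/-- `0 ≤ p_n(σ)`.
[cite: Tao2016AveragedNS, §4 Lemma 4.1 (4.8)–(4.10) with the viscous equation displayed before Thm. 4.2, shell-wise in the self-similar variables of §6.4; cell lemma] -/
theorem wtEnergy_nonneg {ε₀ : ℝ} (hε : 0 ≤ ε₀) (W : ℤ → ℝ → Em m) (n : ℕ) (σ : ℝ) :
    0 ≤ wtEnergy ε₀ W n σ := by
  unfold wtEnergy
  exact mul_nonneg (pow_nonneg (physWeight_nonneg hε) _) (by positivity)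

/-- `T₀ = s₀`.
[folklore] -/
private theorem ceilSeq_zero (L s₀ : ℝ) : ceilSeq L s₀ 0 = s₀ := rfl

/-- `T_{j+1} = L T_j²`.
[folklore] -/
private theorem ceilSeq_succ (L s₀ : ℝ) (j : ℕ) : ceilSeq L s₀ (j + 1) = L * ceilSeq L s₀ j ^ 2 := rfl

/-- `0 ≤ T_j` for `L, s₀ ≥ 0`.
[folklore] -/
private theorem ceilSeq_nonneg {L s₀ : ℝ} (hL : 0 ≤ L) (hs : 0 ≤ s₀) : ∀ j, 0 ≤ ceilSeq L s₀ j
  | 0 => hs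
  | j + 1 => by rw [ceilSeq_succ]; exact mul_nonneg hL (sq_nonneg _)

/-! ## (τ′) The quadratic tail recursion — PROVED, `K = 4096`, every spread, every `ε₀ > 0` -/

/-- **(τ′) with the explicit constant `K = 4096 = (4³)²`** (from `C_A ≤ m³ = 64` on comparable tables),
for every spread `R` and every threshold `εs`.
[cite: Tao2016AveragedNS, §4 Lemma 4.1 (4.8)–(4.10), Thm. 4.2 (statement shape), §6.4; cell theorem] -/
theorem tailRecursionAt_4096 (R εs : ℝ) : TailRecursionAt R 4096 εs := by
  intro ε₀ hε₀ _hε1 α hα νh W hν hW n₀ hUB hseed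
  obtain ⟨C, hC⟩ := hUB
  obtain ⟨s₀, hs₀, hseed⟩ := hseed
  have hc : IsCancellingCoeff α := hα.2.1
  have hCA0 : 0 ≤ fluxConst α := fluxConst_nonneg α
  have hCA : fluxConst α ≤ 64 := by
    have h := fluxConst_le_of_abs_le_one α
      (fun i₁ i₂ i₃ => (hα.2.2 i₁ i₂ i₃ (0, 0, 1) (by simp [mem_shiftSet_iff])).1)
    norm_num at h
    exact h
  have hs0 : 0 ≤ s₀ := le_trans (wtEnergy_nonneg hε₀.le W n₀ 0) (hseed 0)
  have hx1 : 1 ≤ 1 + ε₀ := by linarith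
  set L : ℝ := 4096 / νh ^ 2 with hL
  have hL0 : 0 < L := by rw [hL]; positivity
  have hTn : ∀ j, 0 ≤ ceilSeq L s₀ j := ceilSeq_nonneg hL0.le hs0
  have main : ∀ j : ℕ, ∀ σ : ℝ, wtEnergy ε₀ W (n₀ + j) σ ≤ ceilSeq L s₀ j := by
    intro j
    induction j with
    | zero => intro σ; simpa [ceilSeq_zero] using hseed σ
    | succ j ih =>
      intro σ
      have hxn : 0 < (1 + ε₀) ^ (n₀ + j) := by positivity
      have hSE : ∀ σ', physEnergy ε₀ W ((n₀ + j : ℕ) : ℤ) σ' ≤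
          ceilSeq L s₀ j / (1 + ε₀) ^ (n₀ + j) := by
        intro σ'
        rw [le_div_iff₀ hxn]
        have h := ih σ'
        rw [wtEnergy_eq hε₀] at h
        linarith [mul_comm (physEnergy ε₀ W ((n₀ + j : ℕ) : ℤ) σ') ((1 + ε₀) ^ (n₀ + j))]
      have hSE0 : 0 ≤ ceilSeq L s₀ j / (1 + ε₀) ^ (n₀ + j) := div_nonneg (hTn j) hxn.le
      have hstep := physEnergy_succ_le hε₀ hν hW hc hC (N := ((n₀ + j : ℕ) : ℤ)) (by omega)
        hSE0 hSE σ
      rw [rpow_two_mul_succ, zpow_natCast] at hstep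
      have hidx : ((n₀ + (j + 1) : ℕ) : ℤ) = ((n₀ + j : ℕ) : ℤ) + 1 := by push_cast; ring
      rw [ceilSeq_succ, wtEnergy_eq hε₀, hidx]
      show (1 + ε₀) ^ (n₀ + j + 1) * physEnergy ε₀ W (((n₀ + j : ℕ) : ℤ) + 1) σ
        ≤ L * ceilSeq L s₀ j ^ 2
      calc (1 + ε₀) ^ (n₀ + j + 1) * physEnergy ε₀ W (((n₀ + j : ℕ) : ℤ) + 1) σ
          ≤ (1 + ε₀) ^ (n₀ + j + 1) * (fluxConst α * bigLam ε₀ ^ (n₀ + j) *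
              (ceilSeq L s₀ j / (1 + ε₀) ^ (n₀ + j)) / (νh * (1 + ε₀) ^ (2 * (n₀ + j + 1)))) ^ 2 :=
            mul_le_mul_of_nonneg_left hstep (by positivity)
        _ ≤ 4096 / νh ^ 2 * ceilSeq L s₀ j ^ 2 :=
            weight_step hx1 hν hCA0 hCA (bigLam_pow_sq hε₀.le (n₀ + j))
        _ = L * ceilSeq L s₀ j ^ 2 := by rw [hL]
  refine ⟨fun n => ceilSeq L s₀ (n - n₀), ?_, ?_, ?_, ?_⟩
  · intro n hn σ
    have h := main (n - n₀) σ
    rw [Nat.add_sub_cancel' hn] at h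
    exact h
  · intro n _
    exact hTn _
  · intro n hn
    show ceilSeq L s₀ (n + 1 - n₀) ≤ L * ceilSeq L s₀ (n - n₀) ^ 2
    rw [show n + 1 - n₀ = n - n₀ + 1 by omega, ceilSeq_succ]
  · show L * ceilSeq L s₀ (n₀ - n₀) < 1
    rw [Nat.sub_self, ceilSeq_zero, hL]
    have h : s₀ * 4096 < νh ^ 2 := (lt_div_iff₀ (by norm_num)).mp hs₀
    rw [div_mul_eq_mul_div, div_lt_one (by positivity)]
    linarith

/-- **(τ′) PROVED** (with `K = 4096`, `εs = 1`).
[cite: Tao2016AveragedNS, §4 Lemma 4.1 (4.8)–(4.10), Thm. 4.2 (statement shape), §6.4; cell theorem] -/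
theorem quadraticTailRecursion : QuadraticTailRecursion :=
  fun R _ => ⟨4096, by norm_num, 1, one_pos, tailRecursionAt_4096 R 1⟩

/-! ## Quadratic recursions die; ceilings exclude survival -/

/-- A nonnegative sequence with `S(n+1) ≤ L·S(n)²` from `n₀` on and `L·S(n₀) < 1` decays at least
geometrically: `L·S(n₀+k) ≤ (L·S n₀)^(k+1)`.
[folklore] -/
private theorem quadRecursion_bound {S : ℕ → ℝ} {L : ℝ} {n₀ : ℕ} (hL : 0 < L)
    (hS0 : ∀ n, n₀ ≤ n → 0 ≤ S n) (hrec : ∀ n, n₀ ≤ n → S (n + 1) ≤ L * S n ^ 2)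
    (hseed : L * S n₀ < 1) : ∀ k : ℕ, L * S (n₀ + k) ≤ (L * S n₀) ^ (k + 1) := by
  have hu0 : 0 ≤ L * S n₀ := mul_nonneg hL.le (hS0 n₀ le_rfl)
  intro k
  induction k with
  | zero => simp
  | succ k ih =>
    have hk : n₀ ≤ n₀ + k := Nat.le_add_right _ _
    have hnn : 0 ≤ L * S (n₀ + k) := mul_nonneg hL.le (hS0 _ hk)
    have hle1 : (L * S n₀) ^ (k + 1) ≤ 1 := pow_le_one₀ hu0 hseed.le
    have huk1 : L * S (n₀ + k) ≤ 1 := ih.trans hle1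
    calc L * S (n₀ + (k + 1)) = L * S (n₀ + k + 1) := by rw [Nat.add_assoc]
      _ ≤ L * (L * S (n₀ + k) ^ 2) := mul_le_mul_of_nonneg_left (hrec _ hk) hL.le
      _ = (L * S (n₀ + k)) * (L * S (n₀ + k)) := by ring
      _ ≤ (L * S n₀) ^ (k + 1) * (L * S n₀) := by
          apply mul_le_mul ih (le_trans (le_trans (le_of_eq rfl) ih) (by
            calc (L * S n₀) ^ (k + 1) ≤ (L * S n₀) ^ 1 :=
                  pow_le_pow_of_le_one hu0 hseed.le (by omega)
              _ = L * S n₀ := pow_one _)) hnn (pow_nonneg hu0 _)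
      _ = (L * S n₀) ^ (k + 1 + 1) := by ring

/-- … hence `S n` is eventually below any positive level.
[folklore] -/
private theorem quadRecursion_eventually_lt {S : ℕ → ℝ} {L : ℝ} {n₀ : ℕ} (hL : 0 < L)
    (hS0 : ∀ n, n₀ ≤ n → 0 ≤ S n) (hrec : ∀ n, n₀ ≤ n → S (n + 1) ≤ L * S n ^ 2)
    (hseed : L * S n₀ < 1) (c : ℝ) (hc : 0 < c) : ∃ N : ℕ, ∀ n, N ≤ n → S n < c := by
  have hu0 : 0 ≤ L * S n₀ := mul_nonneg hL.le (hS0 n₀ le_rfl)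
  have ht : Tendsto (fun k : ℕ => (L * S n₀) ^ (k + 1)) atTop (𝓝 0) :=
    (tendsto_pow_atTop_nhds_zero_of_lt_one hu0 hseed).comp (tendsto_add_atTop_nat 1)
  have hLc : 0 < L * c := mul_pos hL hc
  obtain ⟨K, hK⟩ := (ht.eventually (gt_mem_nhds hLc)).exists_forall_of_atTop
  refine ⟨n₀ + K, fun n hn => ?_⟩
  obtain ⟨k, rfl⟩ : ∃ k, n = n₀ + k := ⟨n - n₀, by omega⟩
  have hk : K ≤ k := by omega
  have h1 := quadRecursion_bound hL hS0 hrec hseed k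
  have h2 : (L * S n₀) ^ (k + 1) < L * c := hK k hk
  have h3 : L * S (n₀ + k) < L * c := lt_of_le_of_lt h1 h2
  exact lt_of_mul_lt_mul_left h3 hL.le

/-- Weighted ceilings that are eventually below every positive level exclude forward (S₁)-survival.
[cite: Tao2016AveragedNS, §4 Lemma 4.1 (4.8)–(4.10), Thm. 4.2 (statement shape), §6.4; cell theorem] -/
theorem not_surviving_of_ceilings {ε₀ : ℝ} {W : ℤ → ℝ → Em 4} {S : ℕ → ℝ} {n₀ : ℕ}
    (hS : ∀ n, n₀ ≤ n → ∀ σ, wtEnergy ε₀ W n σ ≤ S n)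
    (hev : ∀ c : ℝ, 0 < c → ∃ N : ℕ, ∀ n, N ≤ n → S n < c) :
    ¬ EternalSurvivingFwd 1 ε₀ W := by
  rintro ⟨c, hc, H⟩
  obtain ⟨N, hN⟩ := hev c hc
  obtain ⟨n, hn, σ, -, hle⟩ := H (max N n₀)
  have h1 : wtEnergy ε₀ W n σ ≤ S n := hS n ((le_max_right _ _).trans hn) σ
  have h2 : S n < c := hN n ((le_max_left _ _).trans hn)
  exact absurd (hle.trans h1) (not_le.mpr h2)

/-! ## Composition: the dissipation-dominated slice is a THEOREM -/

/-- **(τ′) at `(R, K, εs)` ⇒ the slice at `(R, K)`** (kernel glue, any `K > 0`).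
[cite: Tao2016AveragedNS, §4 Lemma 4.1 (4.8)–(4.10), Thm. 4.2 (statement shape), §6.4; cell theorem] -/
theorem noSurvivingViscSeededBdd_of {R K εs : ℝ} (hK : 0 < K) (hεs : 0 < εs)
    (hτ : TailRecursionAt R K εs) : NoSurvivingViscSeededBdd R K := by
  refine ⟨εs, hεs, fun ε₀ hε₀ hle α hα νh W hν hW n₀ hUB hseed => ?_⟩
  obtain ⟨S, hS, hS0, hrec, hsd⟩ := hτ ε₀ hε₀ hle α hα νh W hν hW n₀ hUB hseed
  have hL : 0 < K / νh ^ 2 := div_pos hK (pow_pos hν 2)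
  exact not_surviving_of_ceilings hS (quadRecursion_eventually_lt hL hS0 hrec hsd)

/-- **THE DISSIPATION-DOMINATED SLICE OF THE VISCOUS LIOUVILLE PREDICATE, PROVED** — for every spread `R`,
with `K = 4096` (threshold `εs = 1`, in fact any): an admissible viscous eternal solution (`ν̂ > 0`) of an
E₂(R) table obeying the type-I bound above a shell `n₀` whose a=1-weighted energy stays below `ν̂²/4096` at
all log-times is NOT forward (S₁)-surviving.
[cite: Tao2016AveragedNS, §4 Lemma 4.1 (4.8)–(4.10), Thm. 4.2 (statement shape), §6.4; cell theorem] -/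
theorem noSurvivingViscSeededBdd (R : ℝ) : NoSurvivingViscSeededBdd R 4096 :=
  noSurvivingViscSeededBdd_of (by norm_num) one_pos (tailRecursionAt_4096 R 1)

/-- Packaging: `∀ R ≥ 1, ∃ K > 0, NoSurvivingViscSeededBdd R K`.
[cite: Tao2016AveragedNS, §4 Lemma 4.1 (4.8)–(4.10), Thm. 4.2 (statement shape), §6.4; cell theorem] -/
theorem noSurvivingVisc_dissipationDominated :
    ∀ R : ℝ, 1 ≤ R → ∃ K : ℝ, 0 < K ∧ NoSurvivingViscSeededBdd R K :=
  fun R _ => ⟨4096, by norm_num, noSurvivingViscSeededBdd R⟩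

/-- Sanity: the seed hypothesis is met by the ZERO field at every shell (and the type-I bound trivially).
[cite: Tao2016AveragedNS, §4 Lemma 4.1 (4.8)–(4.10) with the viscous equation displayed before Thm. 4.2, shell-wise in the self-similar variables of §6.4; cell lemma] -/
theorem seed_of_zero {ε₀ νh K : ℝ} (hν : 0 < νh) (hK : 0 < K) (n₀ : ℕ) :
    ∃ s₀ : ℝ, s₀ < νh ^ 2 / K ∧ ∀ σ : ℝ, wtEnergy ε₀ (fun _ _ => (0 : Em 4)) n₀ σ ≤ s₀ :=
  ⟨0, div_pos (pow_pos hν 2) hK, fun σ => by simp [wtEnergy]⟩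


end ViscousTail

/-! ## The bounded («type-I») viscous pair: comparison with the unrestricted predicates, glue, and the
## decomposition of the bounded Liouville predicate at `a = 1` into the proved slice and two residuals -/

section BoundedPair

/-- The bounded viscous Liouville predicate is WEAKER than `NoSurvivingEternalVisc`.
[cite: Tao2016AveragedNS, §4 Thm. 4.2 (statement shape), §6.4; cell glue] -/
theorem noSurvivingEternalViscBdd_of_visc {R a : ℝ} (h : NoSurvivingEternalVisc R a) :
    NoSurvivingEternalViscBdd R a := by
  obtain ⟨εs, hεs, H⟩ := h
  exact ⟨εs, hεs, fun ε₀ hε₀ hle α hα νh W hW _ => H ε₀ hε₀ hle α hα νh W hW⟩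

/-- The bounded rigidity predicate is STRONGER than `EternalRigidityVisc`.
[cite: Tao2016AveragedNS, §4 Thm. 4.2 (statement shape), §6.4; cell glue] -/
theorem eternalRigidityVisc_of_bdd {R a : ℝ} (h : EternalRigidityViscBdd R a) :
    EternalRigidityVisc R a := by
  obtain ⟨εs, hεs, H⟩ := h
  refine ⟨εs, hεs, fun ε₀ hε₀ hle α X₀ hα hNG => ?_⟩
  obtain ⟨νh, W, hW, _, hS⟩ := H ε₀ hε₀ hle α X₀ hα hNG
  exact ⟨νh, W, hW, hS⟩

/-- **GLUE: the bounded visc pair closes `NoRobustBlowupBelow`** (one spread, one exponent).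
[cite: Tao2016AveragedNS, §4 Thm. 4.2 (statement shape), §6.4; cell glue] -/
theorem noRobustBlowupBelow_of_eternalViscBdd {R a : ℝ}
    (h1 : NoSurvivingEternalViscBdd R a) (h2 : EternalRigidityViscBdd R a) : NoRobustBlowupBelow R := by
  obtain ⟨ε₁, hε₁, H1⟩ := h1
  obtain ⟨ε₂, hε₂, H2⟩ := h2
  refine ⟨min ε₁ ε₂, lt_min hε₁ hε₂, fun ε₀ hε₀ hle α X₀ hα hNG => ?_⟩
  obtain ⟨νh, W, hW, hU, hS⟩ := H2 ε₀ hε₀ (hle.trans (min_le_right _ _)) α X₀ hα hNG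
  exact H1 ε₀ hε₀ (hle.trans (min_le_left _ _)) α hα νh W hW hU hS

/-- **The bounded viscous Liouville predicate at `a = 1` from the PROVED slice and the two residual
predicates** `NoSurvivingEternalBdd R 1` (`ν̂ = 0`) and `NoLoudLadder R` (`ν̂ > 0`, unseeded) — kernel glue,
case split `ν̂ = 0` / seeded / unseeded.
[cite: Tao2016AveragedNS, §4 Thm. 4.2 (statement shape), §6.4; cell glue] -/
theorem noSurvivingEternalViscBddOne_of {R : ℝ} (h0 : NoSurvivingEternalBdd R 1) (hL : NoLoudLadder R) :
    NoSurvivingEternalViscBdd R 1 := by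
  obtain ⟨ε₁, hε₁, H0⟩ := h0
  obtain ⟨ε₂, hε₂, HL⟩ := hL
  obtain ⟨ε₃, hε₃, HS⟩ := noSurvivingViscSeededBdd R
  refine ⟨min ε₁ (min ε₂ ε₃), lt_min hε₁ (lt_min hε₂ hε₃), ?_⟩
  intro ε₀ hε₀ hle α hα νh W hW hU
  have hle₁ : ε₀ ≤ ε₁ := hle.trans (min_le_left _ _)
  have hle₂ : ε₀ ≤ ε₂ := hle.trans ((min_le_right _ _).trans (min_le_left _ _))
  have hle₃ : ε₀ ≤ ε₃ := hle.trans ((min_le_right _ _).trans (min_le_right _ _))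
  rcases hW.nonneg.eq_or_lt with hν0 | hνpos
  · -- ν̂ = 0: the inviscid bounded Liouville
    have hW0 : IsEternal ε₀ α W := isEternalVisc_zero_iff.1 (hν0 ▸ hW)
    exact H0 ε₀ hε₀ hle₁ α hα W hW0 hU
  · by_cases hseed : ∃ n₀ : ℕ, ∃ s₀ : ℝ, s₀ < νh ^ 2 / 4096 ∧ ∀ σ : ℝ, wtEnergy ε₀ W n₀ σ ≤ s₀
    · obtain ⟨n₀, s₀, hs₀, hsd⟩ := hseed
      exact HS ε₀ hε₀ hle₃ α hα νh W hνpos hW n₀ (typeIBound_of_uniformBound hU n₀) ⟨s₀, hs₀, hsd⟩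
    · refine HL ε₀ hε₀ hle₂ α hα νh W hνpos hW hU fun n₀ s₀ hs₀ => ?_
      by_contra hno
      push Not at hno
      exact hseed ⟨n₀, s₀, hs₀, hno⟩

/-- **`∀ R ≥ 1, NoRobustBlowupBelow R` from the bounded pair, Liouville side decomposed**: bounded
inviscid Liouville + loud-ladder exclusion + bounded rigidity at `a = 1` (kernel glue; the proved slice is
consumed inside `noSurvivingEternalViscBddOne_of`).
[cite: Tao2016AveragedNS, §4 Thm. 4.2 (statement shape), §6.4; cell glue] -/
theorem noRobustBlowupBelow_of_bdd (h0 : ∀ R : ℝ, 1 ≤ R → NoSurvivingEternalBdd R 1)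
    (hL : ∀ R : ℝ, 1 ≤ R → NoLoudLadder R) (hX : ∀ R : ℝ, 1 ≤ R → EternalRigidityViscBdd R 1) :
    ∀ R : ℝ, 1 ≤ R → NoRobustBlowupBelow R := fun R hR =>
  noRobustBlowupBelow_of_eternalViscBdd (noSurvivingEternalViscBddOne_of (h0 R hR) (hL R hR)) (hX R hR)

end BoundedPair

/-! ## Admissible profile systems are bounded (DSS waves carry uniformly bounded eternal solutions) -/

/-! ### Real-variable lemmas -/

section Real

variable {V : Type*} [NormedAddCommGroup V] [NormedSpace ℝ V]

/-- A `C¹` curve whose speed is dominated by a continuous `g` grows at most by `∫ g`.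
[folklore] -/
private theorem norm_le_norm_add_integral {f : ℝ → V} {f' : ℝ → V} {g : ℝ → ℝ}
    (hf : ∀ x, HasDerivAt f (f' x) x) (hg : Continuous g) (hbound : ∀ x, ‖f' x‖ ≤ g x)
    {y x₁ : ℝ} (hyx : y ≤ x₁) : ‖f x₁‖ ≤ ‖f y‖ + ∫ s in y..x₁, g s := by
  have hB : ∀ x, HasDerivAt (fun x => ‖f y‖ + ∫ s in y..x, g s) (g x) x := fun x =>
    ((hg.integral_hasStrictDerivAt y x).hasDerivAt).const_add _
  have h := image_norm_le_of_norm_deriv_right_le_deriv_boundary (f := f) (f' := f') (a := y)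
    (b := x₁) (fun x _ => (hf x).continuousAt.continuousWithinAt)
    (fun x _ => (hf x).hasDerivWithinAt) (B := fun x => ‖f y‖ + ∫ s in y..x, g s) (B' := g)
    (by simp) hB (fun x _ => hbound x)
  exact h (right_mem_Icc.mpr hyx)

/-- An interval integral of a nonnegative integrable function is dominated by a left-tail integral.
[folklore] -/
private theorem intervalIntegral_le_Iic {u : ℝ → ℝ} (hu : Integrable u) (hu_nn : ∀ x, 0 ≤ u x)
    {a b Z : ℝ} (hab : a ≤ b) (hbZ : b ≤ Z) : ∫ s in a..b, u s ≤ ∫ s in Iic Z, u s := by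
  rw [integral_of_le hab]
  have hsub : Ioc a b ⊆ Iic Z := Ioc_subset_Iic_self.trans (Iic_subset_Iic.mpr hbZ)
  exact setIntegral_mono_set hu.integrableOn (ae_of_all _ fun x => hu_nn x)
    (ae_of_all _ fun x hx => hsub hx)

/-- Left tails of an integrable function are small. [folklore] -/
private theorem exists_tail_le {u : ℝ → ℝ} (hu : Integrable u) {δ : ℝ} (hδ : 0 < δ) :
    ∃ Z : ℝ, ∫ s in Iic Z, u s ≤ δ := by
  have hanti : Antitone (fun n : ℕ => Iic (-(n : ℝ))) := by
    intro a b hab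
    exact Iic_subset_Iic.mpr (by exact_mod_cast neg_le_neg (Nat.cast_le.mpr hab))
  have hlim := tendsto_setIntegral_of_antitone (μ := volume) (f := u)
    (fun n : ℕ => (measurableSet_Iic : MeasurableSet (Iic (-(n : ℝ))))) hanti
    ⟨0, hu.integrableOn⟩
  have hempty : (⋂ n : ℕ, Iic (-(n : ℝ))) = ∅ := by
    ext x
    simp only [mem_iInter, mem_Iic, mem_empty_iff_false, iff_false, not_forall, not_le]
    obtain ⟨n, hn⟩ := exists_nat_gt (-x)
    exact ⟨n, by linarith⟩
  rw [hempty, Measure.restrict_empty, integral_zero_measure] at hlim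
  obtain ⟨n, hn⟩ := ((tendsto_order.1 hlim).2 δ hδ).exists
  exact ⟨-(n : ℝ), hn.le⟩

/-- A continuous integrable nonnegative function takes values `≤ 1` arbitrarily far to the left.
[folklore] -/
private theorem exists_le_val_le_one {u : ℝ → ℝ} (hu : Integrable u) (hu_cont : Continuous u)
    (hu_nn : ∀ x, 0 ≤ u x) (K : ℝ) : ∃ y ≤ K, u y ≤ 1 := by
  by_contra h
  push Not at h
  set M : ℝ := ∫ x, u x
  obtain ⟨n, hn⟩ := exists_nat_gt M
  have hKn : K - n ≤ K := by
    have : (0 : ℝ) ≤ n := Nat.cast_nonneg n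
    linarith
  have h1 : ∫ s in (K - n)..K, (1 : ℝ) ≤ ∫ s in (K - n)..K, u s :=
    integral_mono_on hKn intervalIntegrable_const (hu_cont.intervalIntegrable _ _)
      fun x hx => (h x hx.2).le
  have h2 : ∫ s in (K - n)..K, u s ≤ M := by
    rw [integral_of_le hKn]
    exact setIntegral_le_integral hu (ae_of_all _ fun x => hu_nn x)
  rw [intervalIntegral.integral_const, smul_eq_mul, mul_one] at h1
  have : (n : ℝ) ≤ M := by linarith
  linarith

end Real

/-! ### The abstract profile system -/

section Abstract

variable {V : Type*} [NormedAddCommGroup V]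
variable {ρ : Type*} [Fintype ρ]

/-- `Σ_r ‖Φ r x‖² ≤ (Σ_r ‖Φ r x‖)²`. [folklore] -/
private theorem sEnergy_le_sMass_sq (Φ : ρ → ℝ → V) (x : ℝ) : sEnergy Φ x ≤ sMass Φ x ^ 2 := by
  unfold sEnergy
  calc (∑ r, ‖Φ r x‖ ^ 2) ≤ ∑ r, ‖Φ r x‖ * sMass Φ x := by
        refine Finset.sum_le_sum fun r _ => ?_
        rw [sq]
        exact mul_le_mul_of_nonneg_left (norm_le_sMass Φ x r) (norm_nonneg _)
    _ = sMass Φ x ^ 2 := by rw [← Finset.sum_mul, sq]; rfl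

variable [InnerProductSpace ℝ V]

/-- **Key estimate.**  If the summed mass is `≤ L` on the window `[y, x₁ + T]`, then
`u(x₁) ≤ u(y) + (|d| + κ L) ∫_{(-∞, x₁+T]} u` with `κ = K_Q + |c₁| K_A + |c₂| K_B`.
[cite: Tao2016AveragedNS, §4 Lemma 4.1 (4.8) (the profile system); cell lemma] -/
theorem sMass_key_estimate {π : Equiv.Perm ρ} {Q A : V → V} {B : V → V → V} {d c₁ c₂ T : ℝ}
    {Φ : ρ → ℝ → V} (hΦ : IsSWave π Q A B d c₁ c₂ T Φ) (hT : 0 ≤ T)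
    {KQ KA KB : ℝ} (hKQ : 0 ≤ KQ) (hKA : 0 ≤ KA) (hKB : 0 ≤ KB)
    (hQ : ∀ v, ‖Q v‖ ≤ KQ * ‖v‖ ^ 2) (hA : ∀ v, ‖A v‖ ≤ KA * ‖v‖ ^ 2)
    (hB : ∀ w v, ‖B w v‖ ≤ KB * ‖w‖ * ‖v‖)
    (hmass : Integrable (sMass Φ)) {y x₁ L : ℝ} (hyx : y ≤ x₁)
    (hwin : ∀ z ∈ Icc y (x₁ + T), sMass Φ z ≤ L) :
    sMass Φ x₁ ≤ sMass Φ y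
      + (|d| + (KQ + |c₁| * KA + |c₂| * KB) * L) * ∫ s in Iic (x₁ + T), sMass Φ s := by
  set u := sMass Φ with hu_def
  have hu_cont : Continuous u := hΦ.continuous_sMass
  have hu_nn : ∀ x, 0 ≤ u x := sMass_nonneg Φ
  have hcont : ∀ r, Continuous (Φ r) := hΦ.continuous
  have hL : 0 ≤ L := le_trans (hu_nn y) (hwin y ⟨le_rfl, by linarith⟩)
  -- the dominating functions
  set g : ρ → ℝ → ℝ := fun r s => |d| * ‖Φ r s‖ + KQ * ‖Φ r s‖ ^ 2
      + |c₁| * KA * ‖Φ (π.symm r) (s + T)‖ ^ 2 + |c₂| * KB * (‖Φ (π r) (s - T)‖ * ‖Φ r s‖)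
    with hg_def
  have hg_cont : ∀ r, Continuous (g r) := by
    intro r
    have h1 : Continuous (Φ r) := hcont r
    have h2 : Continuous (Φ (π.symm r)) := hcont _
    have h3 : Continuous (Φ (π r)) := hcont _
    simp only [hg_def]
    fun_prop
  -- speed bound from the law
  have hspeed : ∀ r x, ‖-(d • Φ r x) + Q (Φ r x) + c₁ • A (Φ (π.symm r) (x + T))
      + c₂ • B (Φ (π r) (x - T)) (Φ r x)‖ ≤ g r x := by
    intro r x
    have e1 : ‖-(d • Φ r x)‖ = |d| * ‖Φ r x‖ := by rw [norm_neg, norm_smul, Real.norm_eq_abs]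
    have e2 : ‖c₁ • A (Φ (π.symm r) (x + T))‖ ≤ |c₁| * KA * ‖Φ (π.symm r) (x + T)‖ ^ 2 := by
      rw [norm_smul, Real.norm_eq_abs, mul_assoc]
      exact mul_le_mul_of_nonneg_left (hA _) (abs_nonneg _)
    have e3 : ‖c₂ • B (Φ (π r) (x - T)) (Φ r x)‖
        ≤ |c₂| * KB * (‖Φ (π r) (x - T)‖ * ‖Φ r x‖) := by
      rw [norm_smul, Real.norm_eq_abs, mul_assoc]
      refine mul_le_mul_of_nonneg_left ?_ (abs_nonneg _)
      have := hB (Φ (π r) (x - T)) (Φ r x)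
      linarith [this]
    have i1 := norm_add_le (-(d • Φ r x) + Q (Φ r x) + c₁ • A (Φ (π.symm r) (x + T)))
      (c₂ • B (Φ (π r) (x - T)) (Φ r x))
    have i2 := norm_add_le (-(d • Φ r x) + Q (Φ r x)) (c₁ • A (Φ (π.symm r) (x + T)))
    have i3 := norm_add_le (-(d • Φ r x)) (Q (Φ r x))
    simp only [hg_def]
    linarith [hQ (Φ r x), e1, e2, e3, i1, i2, i3]
  -- per-profile integral bound, summed
  have hper : ∀ r, ‖Φ r x₁‖ ≤ ‖Φ r y‖ + ∫ s in y..x₁, g r s := fun r =>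
    norm_le_norm_add_integral (hΦ r) (hg_cont r) (hspeed r) hyx
  have hsum : u x₁ ≤ u y + ∑ r, ∫ s in y..x₁, g r s := by
    have : u x₁ = ∑ r, ‖Φ r x₁‖ := rfl
    have huy : u y = ∑ r, ‖Φ r y‖ := rfl
    rw [this, huy, ← Finset.sum_add_distrib]
    exact Finset.sum_le_sum fun r _ => hper r
  rw [← intervalIntegral.integral_finsetSum (fun r _ => (hg_cont r).intervalIntegrable _ _)] at hsum
  -- pointwise domination of `Σ_r g r` on `[y, x₁]`
  set H : ℝ → ℝ := fun s => |d| * u s + KQ * L * u s + |c₁| * KA * L * u (s + T)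
      + |c₂| * KB * L * u (s - T) with hH_def
  have hH_cont : Continuous H := by
    simp only [hH_def]
    fun_prop
  have hdom : ∀ s ∈ Icc y x₁, (∑ r, g r s) ≤ H s := by
    intro s hs
    have hs0 : u s ≤ L := hwin s ⟨hs.1, by linarith [hs.2]⟩
    have hsT : u (s + T) ≤ L := hwin (s + T) ⟨by linarith [hs.1], by linarith [hs.2]⟩
    -- (i) Σ ‖Φ r s‖ = u s
    have t1 : (∑ r, |d| * ‖Φ r s‖) = |d| * u s := by rw [← Finset.mul_sum]; rfl
    -- (ii) Σ ‖Φ r s‖² ≤ L u s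
    have t2 : (∑ r, KQ * ‖Φ r s‖ ^ 2) ≤ KQ * L * u s := by
      rw [← Finset.mul_sum, mul_assoc]
      refine mul_le_mul_of_nonneg_left ?_ hKQ
      calc (∑ r, ‖Φ r s‖ ^ 2) = sEnergy Φ s := rfl
        _ ≤ u s ^ 2 := sEnergy_le_sMass_sq Φ s
        _ = u s * u s := sq _
        _ ≤ L * u s := mul_le_mul_of_nonneg_right hs0 (hu_nn s)
    -- (iii) Σ ‖Φ (π⁻¹ r) (s+T)‖² ≤ L u (s+T)
    have t3 : (∑ r, |c₁| * KA * ‖Φ (π.symm r) (s + T)‖ ^ 2) ≤ |c₁| * KA * L * u (s + T) := by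
      rw [← Finset.mul_sum, mul_assoc (|c₁| * KA)]
      refine mul_le_mul_of_nonneg_left ?_ (mul_nonneg (abs_nonneg _) hKA)
      have hre : (∑ r, ‖Φ (π.symm r) (s + T)‖ ^ 2) = ∑ r, ‖Φ r (s + T)‖ ^ 2 :=
        Equiv.sum_comp π.symm (fun r => ‖Φ r (s + T)‖ ^ 2)
      rw [hre]
      calc (∑ r, ‖Φ r (s + T)‖ ^ 2) = sEnergy Φ (s + T) := rfl
        _ ≤ u (s + T) ^ 2 := sEnergy_le_sMass_sq Φ (s + T)
        _ = u (s + T) * u (s + T) := sq _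
        _ ≤ L * u (s + T) := mul_le_mul_of_nonneg_right hsT (hu_nn _)
    -- (iv) Σ ‖Φ (π r) (s-T)‖ ‖Φ r s‖ ≤ L u (s-T)
    have t4 : (∑ r, |c₂| * KB * (‖Φ (π r) (s - T)‖ * ‖Φ r s‖))
        ≤ |c₂| * KB * L * u (s - T) := by
      rw [← Finset.mul_sum, mul_assoc (|c₂| * KB)]
      refine mul_le_mul_of_nonneg_left ?_ (mul_nonneg (abs_nonneg _) hKB)
      have hre : (∑ r, ‖Φ (π r) (s - T)‖) = u (s - T) :=
        Equiv.sum_comp π (fun r => ‖Φ r (s - T)‖)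
      calc (∑ r, ‖Φ (π r) (s - T)‖ * ‖Φ r s‖) ≤ ∑ r, ‖Φ (π r) (s - T)‖ * L :=
            Finset.sum_le_sum fun r _ => mul_le_mul_of_nonneg_left
              ((norm_le_sMass Φ s r).trans hs0) (norm_nonneg _)
        _ = L * u (s - T) := by rw [← Finset.sum_mul, hre, mul_comm]
    have hsplit : (∑ r, g r s) = (∑ r, |d| * ‖Φ r s‖) + (∑ r, KQ * ‖Φ r s‖ ^ 2)
        + (∑ r, |c₁| * KA * ‖Φ (π.symm r) (s + T)‖ ^ 2)
        + (∑ r, |c₂| * KB * (‖Φ (π r) (s - T)‖ * ‖Φ r s‖)) := by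
      simp only [hg_def, Finset.sum_add_distrib]
    rw [hsplit, t1]
    simp only [hH_def]
    linarith [t2, t3, t4]
  have hmono : ∫ s in y..x₁, (∑ r, g r s) ≤ ∫ s in y..x₁, H s :=
    integral_mono_on hyx ((continuous_finsetSum _ fun r _ => hg_cont r).intervalIntegrable _ _)
      (hH_cont.intervalIntegrable _ _) hdom
  -- evaluate `∫ H`
  have hii : ∀ a b, IntervalIntegrable u volume a b := fun a b => hu_cont.intervalIntegrable a b
  have hiiT : ∀ a b, IntervalIntegrable (fun s => u (s + T)) volume a b := fun a b =>
    (hu_cont.comp (continuous_id.add continuous_const)).intervalIntegrable a b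
  have hiiT' : ∀ a b, IntervalIntegrable (fun s => u (s - T)) volume a b := fun a b =>
    (hu_cont.comp (continuous_id.sub continuous_const)).intervalIntegrable a b
  set μ := ∫ s in Iic (x₁ + T), u s with hμ_def
  have hμ_nn : 0 ≤ μ := setIntegral_nonneg measurableSet_Iic fun x _ => hu_nn x
  have hI0 : ∫ s in y..x₁, u s ≤ μ := intervalIntegral_le_Iic hmass hu_nn hyx (by linarith)
  have hIp : ∫ s in y..x₁, u (s + T) ≤ μ := by
    rw [intervalIntegral.integral_comp_add_right (f := u)]
    exact intervalIntegral_le_Iic hmass hu_nn (by linarith) le_rfl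
  have hIm : ∫ s in y..x₁, u (s - T) ≤ μ := by
    rw [intervalIntegral.integral_comp_sub_right (f := u)]
    exact intervalIntegral_le_Iic hmass hu_nn (by linarith) (by linarith)
  have hH_int : ∫ s in y..x₁, H s = |d| * (∫ s in y..x₁, u s) + KQ * L * (∫ s in y..x₁, u s)
      + |c₁| * KA * L * (∫ s in y..x₁, u (s + T))
      + |c₂| * KB * L * (∫ s in y..x₁, u (s - T)) := by
    simp only [hH_def]
    rw [intervalIntegral.integral_add, intervalIntegral.integral_add, intervalIntegral.integral_add,
      intervalIntegral.integral_const_mul,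
      intervalIntegral.integral_const_mul, intervalIntegral.integral_const_mul,
      intervalIntegral.integral_const_mul]
    all_goals exact Continuous.intervalIntegrable (by fun_prop) _ _
  have hH_le : ∫ s in y..x₁, H s ≤ (|d| + (KQ + |c₁| * KA + |c₂| * KB) * L) * μ := by
    rw [hH_int]
    have a1 : |d| * (∫ s in y..x₁, u s) ≤ |d| * μ := mul_le_mul_of_nonneg_left hI0 (abs_nonneg _)
    have a2 : KQ * L * (∫ s in y..x₁, u s) ≤ KQ * L * μ :=
      mul_le_mul_of_nonneg_left hI0 (mul_nonneg hKQ hL)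
    have a3 : |c₁| * KA * L * (∫ s in y..x₁, u (s + T)) ≤ |c₁| * KA * L * μ :=
      mul_le_mul_of_nonneg_left hIp (mul_nonneg (mul_nonneg (abs_nonneg _) hKA) hL)
    have a4 : |c₂| * KB * L * (∫ s in y..x₁, u (s - T)) ≤ |c₂| * KB * L * μ :=
      mul_le_mul_of_nonneg_left hIm (mul_nonneg (mul_nonneg (abs_nonneg _) hKB) hL)
    have hexp : (|d| + (KQ + |c₁| * KA + |c₂| * KB) * L) * μ
        = |d| * μ + KQ * L * μ + |c₁| * KA * L * μ + |c₂| * KB * L * μ := by ring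
    rw [hexp]
    linarith [a1, a2, a3, a4]
  linarith [hsum, hmono, hH_le]

/-- **Admissible profile systems are bounded.**  Integrable summed mass, a bound on a right
half-line and the quadratic structure force `sup_ℝ Σ_r ‖Φ r‖ < ∞`.
[cite: Tao2016AveragedNS, §4 Lemma 4.1 (4.8); cell theorem] -/
theorem sMass_bounded {π : Equiv.Perm ρ} {Q A : V → V} {B : V → V → V} {d c₁ c₂ T : ℝ}
    {Φ : ρ → ℝ → V} (hΦ : IsSWave π Q A B d c₁ c₂ T Φ) (hT : 0 ≤ T)
    {KQ KA KB : ℝ} (hKQ : 0 ≤ KQ) (hKA : 0 ≤ KA) (hKB : 0 ≤ KB)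
    (hQ : ∀ v, ‖Q v‖ ≤ KQ * ‖v‖ ^ 2) (hA : ∀ v, ‖A v‖ ≤ KA * ‖v‖ ^ 2)
    (hB : ∀ w v, ‖B w v‖ ≤ KB * ‖w‖ * ‖v‖)
    (hmass : Integrable (sMass Φ)) (hbdd : ∃ x₀ P : ℝ, ∀ x, x₀ ≤ x → sMass Φ x ≤ P) :
    ∃ C : ℝ, ∀ x, sMass Φ x ≤ C := by
  set u := sMass Φ with hu_def
  have hu_cont : Continuous u := hΦ.continuous_sMass
  have hu_nn : ∀ x, 0 ≤ u x := sMass_nonneg Φ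
  set κ := KQ + |c₁| * KA + |c₂| * KB with hκ_def
  have hκ : 0 ≤ κ := by positivity
  set δ : ℝ := 1 / (2 * (|d| + κ + 1)) with hδ_def
  have hden : 0 < 2 * (|d| + κ + 1) := by positivity
  have hδ : 0 < δ := by positivity
  have hprod : δ * (2 * (|d| + κ + 1)) = 1 := by
    rw [hδ_def]; field_simp
  have hdδ : |d| * δ ≤ 1 / 2 := by
    nlinarith [hprod, mul_nonneg hδ.le hκ, hδ.le, abs_nonneg d]
  have hκδ : κ * δ ≤ 1 / 2 := by
    nlinarith [hprod, mul_nonneg hδ.le (abs_nonneg d), hδ.le]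
  obtain ⟨Z, hZ⟩ := exists_tail_le hmass hδ
  set Z' := Z - T with hZ'_def
  obtain ⟨x₀, P, hP⟩ := hbdd
  -- a-priori bound on `[Z', ∞)`
  obtain ⟨B₁, hB₁⟩ : ∃ B₁, ∀ x ∈ Icc Z' (max x₀ Z'), u x ≤ B₁ := by
    obtain ⟨B₁, hB₁⟩ := (isCompact_Icc (a := Z') (b := max x₀ Z')).bddAbove_image
      hu_cont.continuousOn
    exact ⟨B₁, fun x hx => hB₁ (mem_image_of_mem u hx)⟩
  have hfar : ∀ x, Z' ≤ x → u x ≤ max B₁ P := by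
    intro x hx
    by_cases hx0 : x₀ ≤ x
    · exact (hP x hx0).trans (le_max_right _ _)
    · push Not at hx0
      exact (hB₁ x ⟨hx, le_trans hx0.le (le_max_left _ _)⟩).trans (le_max_left _ _)
  refine ⟨max 4 (max B₁ P), fun x => ?_⟩
  by_cases hx : Z' ≤ x
  · exact (hfar x hx).trans (le_max_right _ _)
  push Not at hx
  obtain ⟨y, hyx, hy1⟩ := exists_le_val_le_one hmass hu_cont hu_nn x
  have hne : (Icc y (Z' + T)).Nonempty := nonempty_Icc.mpr (by linarith)
  obtain ⟨s, hs_mem, hs_max⟩ := (isCompact_Icc (a := y) (b := Z' + T)).exists_isMaxOn hne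
    hu_cont.continuousOn
  have hmax : ∀ z ∈ Icc y (Z' + T), u z ≤ u s := isMaxOn_iff.mp hs_max
  have hxs : u x ≤ u s := hmax x ⟨hyx, by linarith⟩
  by_cases hsZ : Z' ≤ s
  · exact hxs.trans ((hfar s hsZ).trans (le_max_right _ _))
  push Not at hsZ
  have hwin : ∀ z ∈ Icc y (s + T), u z ≤ u s := fun z hz =>
    hmax z ⟨hz.1, le_trans hz.2 (by linarith)⟩
  have key := sMass_key_estimate hΦ hT hKQ hKA hKB hQ hA hB hmass hs_mem.1 hwin
  have hμ : ∫ z in Iic (s + T), u z ≤ δ := by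
    refine le_trans ?_ hZ
    have hsT : s + T ≤ Z := by rw [hZ'_def] at hsZ; linarith
    have hsub : Iic (s + T) ⊆ Iic Z := Iic_subset_Iic.mpr hsT
    exact setIntegral_mono_set hmass.integrableOn (ae_of_all _ fun z => hu_nn z)
      (ae_of_all _ fun z hz => hsub hz)
  have hμ_nn : 0 ≤ ∫ z in Iic (s + T), u z := setIntegral_nonneg measurableSet_Iic fun z _ => hu_nn z
  have hus : 0 ≤ u s := hu_nn s
  -- u s ≤ 1 + (|d| + κ u s) δ ≤ 1 + 1/2 + u s / 2
  have h1 : u s ≤ 1 + (|d| + κ * u s) * δ := by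
    have hcoef : 0 ≤ |d| + κ * u s := by positivity
    calc u s ≤ u y + (|d| + κ * u s) * ∫ z in Iic (s + T), u z := key
      _ ≤ 1 + (|d| + κ * u s) * δ := add_le_add hy1 (mul_le_mul_of_nonneg_left hμ hcoef)
  have h2 : u s ≤ 4 := by
    have hk : κ * δ * u s ≤ 1 / 2 * u s := mul_le_mul_of_nonneg_right hκδ hus
    nlinarith [h1, hdδ, hκδ, hus, hk]
  exact hxs.trans (h2.trans (le_max_left _ _))

end Abstract

/-! ### Tables: norm bounds for `Q`, `A`, `B`; DSS waves are bounded; the bounded inviscid predicate excludes surviving DSS waves -/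

section Tables

variable {m : ℕ}
variable {ρ : Type*} [Fintype ρ]

/-- `Σ_{i,i₁,i₂} |α_{i₁ i₂ i, μ}|` — the `ℓ¹` size of the shift-`μ` block of a table
(`shiftConst α (0,0,1) = fluxConst α`).
[cite: Tao2016AveragedNS, §4 (4.1); cell vocabulary] -/
def shiftConst (α : Fin m → Fin m → Fin m → ℤ × ℤ × ℤ → ℝ) (μ : ℤ × ℤ × ℤ) : ℝ :=
  ∑ i, ∑ i₁, ∑ i₂, |α i₁ i₂ i μ|

/-- [cite: Tao2016AveragedNS, §4 (4.1); cell vocabulary] -/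
theorem shiftConst_nonneg (α : Fin m → Fin m → Fin m → ℤ × ℤ × ℤ → ℝ) (μ : ℤ × ℤ × ℤ) :
    0 ≤ shiftConst α μ :=
  Finset.sum_nonneg fun _ _ => Finset.sum_nonneg fun _ _ =>
    Finset.sum_nonneg fun _ _ => abs_nonneg _

/-- `|qform α μ y x i| ≤ (Σ_{i₁ i₂} |α_{i₁ i₂ i μ}|) ‖y‖ ‖x‖`.
[cite: Tao2016AveragedNS, §4 (4.1), Lemma 4.1 (4.8); cell lemma] -/
theorem abs_qform_le (α : Fin m → Fin m → Fin m → ℤ × ℤ × ℤ → ℝ) (μ : ℤ × ℤ × ℤ)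
    (y x : Em m) (i : Fin m) :
    |qform α μ y x i| ≤ (∑ i₁, ∑ i₂, |α i₁ i₂ i μ|) * (‖y‖ * ‖x‖) := by
  unfold qform
  calc |∑ i₁, ∑ i₂, α i₁ i₂ i μ * (y i₁ * x i₂)|
      ≤ ∑ i₁, |∑ i₂, α i₁ i₂ i μ * (y i₁ * x i₂)| := Finset.abs_sum_le_sum_abs _ _
    _ ≤ ∑ i₁, ∑ i₂, |α i₁ i₂ i μ * (y i₁ * x i₂)| :=
        Finset.sum_le_sum fun _ _ => Finset.abs_sum_le_sum_abs _ _
    _ ≤ ∑ i₁, ∑ i₂, |α i₁ i₂ i μ| * (‖y‖ * ‖x‖) := by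
        refine Finset.sum_le_sum fun i₁ _ => Finset.sum_le_sum fun i₂ _ => ?_
        rw [abs_mul, abs_mul]
        refine mul_le_mul_of_nonneg_left ?_ (abs_nonneg _)
        exact mul_le_mul (abs_apply_le_norm y i₁) (abs_apply_le_norm x i₂) (abs_nonneg _)
          (norm_nonneg _)
    _ = (∑ i₁, ∑ i₂, |α i₁ i₂ i μ|) * (‖y‖ * ‖x‖) := by
        rw [Finset.sum_mul]
        exact Finset.sum_congr rfl fun _ _ => by rw [Finset.sum_mul]

/-- [cite: Tao2016AveragedNS, §4 (4.1), Lemma 4.1 (4.8); cell lemma] -/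
theorem norm_sum_qform_single_le (α : Fin m → Fin m → Fin m → ℤ × ℤ × ℤ → ℝ) (μ : ℤ × ℤ × ℤ)
    (y x : Em m) :
    ‖∑ i, qform α μ y x i • EuclideanSpace.single i (1 : ℝ)‖ ≤ shiftConst α μ * (‖y‖ * ‖x‖) := by
  calc ‖∑ i, qform α μ y x i • EuclideanSpace.single i (1 : ℝ)‖
      ≤ ∑ i, ‖qform α μ y x i • EuclideanSpace.single i (1 : ℝ)‖ := norm_sum_le _ _
    _ = ∑ i, |qform α μ y x i| := by
        refine Finset.sum_congr rfl fun i _ => ?_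
        rw [norm_smul, PiLp.norm_single, norm_one, mul_one, Real.norm_eq_abs]
    _ ≤ ∑ i, (∑ i₁, ∑ i₂, |α i₁ i₂ i μ|) * (‖y‖ * ‖x‖) :=
        Finset.sum_le_sum fun i _ => abs_qform_le α μ y x i
    _ = shiftConst α μ * (‖y‖ * ‖x‖) := by unfold shiftConst; rw [Finset.sum_mul]

/-- [cite: Tao2016AveragedNS, §4 (4.1), Lemma 4.1 (4.8); cell lemma] -/
theorem norm_tableQ_le (α : Fin m → Fin m → Fin m → ℤ × ℤ × ℤ → ℝ) (x : Em m) :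
    ‖tableQ α x‖ ≤ shiftConst α (0, 0, 0) * ‖x‖ ^ 2 := by
  rw [sq]; exact norm_sum_qform_single_le α (0, 0, 0) x x

/-- [cite: Tao2016AveragedNS, §4 (4.1), Lemma 4.1 (4.8); cell lemma] -/
theorem norm_tableA_le (α : Fin m → Fin m → Fin m → ℤ × ℤ × ℤ → ℝ) (x : Em m) :
    ‖tableA α x‖ ≤ shiftConst α (0, 0, 1) * ‖x‖ ^ 2 := by
  rw [sq]; exact norm_sum_qform_single_le α (0, 0, 1) x x

/-- [cite: Tao2016AveragedNS, §4 (4.1), Lemma 4.1 (4.8); cell lemma] -/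
theorem norm_tableB_le (α : Fin m → Fin m → Fin m → ℤ × ℤ × ℤ → ℝ) (y x : Em m) :
    ‖tableB α y x‖ ≤ (shiftConst α (1, 0, 0) + shiftConst α (0, 1, 0)) * ‖y‖ * ‖x‖ := by
  have hsplit : tableB α y x = (∑ i, qform α (1, 0, 0) y x i • EuclideanSpace.single i (1 : ℝ))
      + ∑ i, qform α (0, 1, 0) x y i • EuclideanSpace.single i (1 : ℝ) := by
    unfold tableB
    rw [← Finset.sum_add_distrib]
    exact Finset.sum_congr rfl fun i _ => by rw [add_smul]
  rw [hsplit]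
  refine le_trans (norm_add_le _ _) ?_
  have h1 := norm_sum_qform_single_le α (1, 0, 0) y x
  have h2 := norm_sum_qform_single_le α (0, 1, 0) x y
  rw [mul_comm ‖x‖ ‖y‖] at h2
  linarith [h1, h2]

/-- **Every admissible DSS wave has bounded profiles** (any finite table, any `ε₀`).
[cite: Tao2016AveragedNS, §4 Lemma 4.1 (4.8) (the DSS profile system); cell theorem] -/
theorem IsDSSWave.uniformBound {ε₀ : ℝ} {α : Fin m → Fin m → Fin m → ℤ × ℤ × ℤ → ℝ}
    {π : Equiv.Perm ρ} {T : ℝ} {Φ : ρ → ℝ → Em m} (hW : IsDSSWave ε₀ α π T Φ) :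
    ∃ C : ℝ, ∀ (r : ρ) (x : ℝ), ‖Φ r x‖ ≤ C := by
  -- the forward bound: `e^{2x} Σ‖Φ r x‖² ≤ P` on `[x₀, ∞)` ⇒ `Σ ‖Φ r x‖ ≤ |ρ| √(P e^{-2x₀})`
  obtain ⟨x₀, P, hP⟩ := hW.bdd
  have hbdd : ∃ x₀ P' : ℝ, ∀ x, x₀ ≤ x → sMass Φ x ≤ P' := by
    refine ⟨x₀, (Fintype.card ρ : ℝ) * Real.sqrt (P * Real.exp (-(2 * x₀))), fun x hx => ?_⟩
    have hw := hP x hx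
    unfold wEnergy at hw
    have hE : sEnergy Φ x ≤ P * Real.exp (-(2 * x₀)) := by
      have hge : 1 ≤ Real.exp (2 * 1 * x) * Real.exp (-(2 * x₀)) := by
        rw [← Real.exp_add]; exact Real.one_le_exp (by linarith)
      have hs := sEnergy_nonneg Φ x
      calc sEnergy Φ x = sEnergy Φ x * 1 := (mul_one _).symm
        _ ≤ sEnergy Φ x * (Real.exp (2 * 1 * x) * Real.exp (-(2 * x₀))) :=
            mul_le_mul_of_nonneg_left hge hs
        _ = (Real.exp (2 * 1 * x) * sEnergy Φ x) * Real.exp (-(2 * x₀)) := by ring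
        _ ≤ P * Real.exp (-(2 * x₀)) := mul_le_mul_of_nonneg_right hw (Real.exp_pos _).le
    have hr : ∀ r, ‖Φ r x‖ ≤ Real.sqrt (P * Real.exp (-(2 * x₀))) := by
      intro r
      have hsq : ‖Φ r x‖ ^ 2 ≤ sEnergy Φ x :=
        Finset.single_le_sum (f := fun r' => ‖Φ r' x‖ ^ 2) (fun _ _ => by positivity)
          (Finset.mem_univ r)
      calc ‖Φ r x‖ = Real.sqrt (‖Φ r x‖ ^ 2) := by rw [Real.sqrt_sq (norm_nonneg _)]
        _ ≤ Real.sqrt (P * Real.exp (-(2 * x₀))) := Real.sqrt_le_sqrt (hsq.trans hE)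
    calc sMass Φ x = ∑ r, ‖Φ r x‖ := rfl
      _ ≤ ∑ _r : ρ, Real.sqrt (P * Real.exp (-(2 * x₀))) := Finset.sum_le_sum fun r _ => hr r
      _ = (Fintype.card ρ : ℝ) * Real.sqrt (P * Real.exp (-(2 * x₀))) := by
          rw [Finset.sum_const, nsmul_eq_mul, Finset.card_univ]
  have hB : ∀ w v : Em m, ‖tableB α w v‖
      ≤ (shiftConst α (1, 0, 0) + shiftConst α (0, 1, 0)) * ‖w‖ * ‖v‖ := norm_tableB_le α
  obtain ⟨C, hC⟩ := sMass_bounded hW.wave hW.delay_pos.le (shiftConst_nonneg α (0, 0, 0))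
    (shiftConst_nonneg α (0, 0, 1))
    (add_nonneg (shiftConst_nonneg α (1, 0, 0)) (shiftConst_nonneg α (0, 1, 0)))
    (norm_tableQ_le α) (norm_tableA_le α) hB hW.mass hbdd
  exact ⟨C, fun r x => (norm_le_sMass Φ x r).trans (hC x)⟩

/-- **The eternal solution carried by a DSS wave is uniformly bounded** in shell and log-time:
every DSS wave lies in the hypothesis class of the bounded inviscid Liouville predicate `NoSurvivingEternalBdd`.
[cite: Tao2016AveragedNS, §4 Lemma 4.1 (4.8); cell theorem] -/
theorem uniformBound_dssEmbed {ε₀ : ℝ} {α : Fin m → Fin m → Fin m → ℤ × ℤ × ℤ → ℝ}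
    {π : Equiv.Perm ρ} {T : ℝ} {Φ : ρ → ℝ → Em m} (hW : IsDSSWave ε₀ α π T Φ) (r₀ : ρ) :
    UniformBound (dssEmbed π T Φ r₀) := by
  obtain ⟨C, hC⟩ := hW.uniformBound
  exact ⟨C, fun k σ => hC _ _⟩

/-- `NoSurvivingEternalFwd R a → NoSurvivingEternalBdd R a` (the bounded predicate is weaker).
[cite: Tao2016AveragedNS, §4 Thm. 4.2 (statement shape); cell vocabulary] -/
theorem noSurvivingEternalBdd_of_fwd {R a : ℝ} (h : NoSurvivingEternalFwd R a) :
    NoSurvivingEternalBdd R a := by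
  obtain ⟨εs, hεs, H⟩ := h
  exact ⟨εs, hεs, fun ε₀ hε₀ hle α hα W hW _ => H ε₀ hε₀ hle α hα W hW⟩

/-- **`NoSurvivingEternalBdd R a → NoSurvivingDSS R a`**: the bounded inviscid Liouville predicate excludes
surviving DSS waves, because the
eternal solution carried by a DSS wave is automatically uniformly bounded (`uniformBound_dssEmbed`).
[cite: Tao2016AveragedNS, §4 Thm. 4.2 (statement shape); cell theorem] -/
theorem noSurvivingDSS_of_noSurvivingEternalBdd {R a : ℝ} (h : NoSurvivingEternalBdd R a) :
    NoSurvivingDSS R a := by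
  obtain ⟨εs, hεs, H⟩ := h
  refine ⟨εs, hεs, fun ε₀ hε₀ hle α hα q π T Φ hW hS r x => ?_⟩
  by_contra hne
  exact H ε₀ hε₀ hle α hα (dssEmbed π T Φ r) (hW.isEternal_dssEmbed r)
    (uniformBound_dssEmbed hW r) (eternalSurvivingFwd_dssEmbed hε₀ hW.delay_pos hS hne)

end Tables

end TaoCascade

end Literature.Analysis.FluidPDE

/-! ## `_holds` aliases (appended 2026-08-28)

The named fact(s) below are already theorems of the tree under another name; the `_holds`
alias records the discharge under the tree's naming convention (D-0026 bookkeeping: proof term =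
the existing theorem, no statement or definition edited). -/

/-- `QuadraticTailRecursion` is a theorem of the tree (`Literature.Analysis.FluidPDE.TaoCascade.quadraticTailRecursion`). [cite: Tao2016AveragedNS, §4 Thm. 4.2 (statement shape), Lemma 4.1 (4.8), §6.4; cell vocabulary] -/
theorem _root_.Literature.Analysis.FluidPDE.TaoCascade.QuadraticTailRecursion_holds : _root_.Literature.Analysis.FluidPDE.TaoCascade.QuadraticTailRecursion :=
  _root_.Literature.Analysis.FluidPDE.TaoCascade.quadraticTailRecursion
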